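import Mathlib
import HarnessLib
import HarnessLib.Audit
import Summits.BirchSwinnertonDyer.Statement
import Literature.NumberTheory.EllipticCurves.KuriharaNumberDeepInvariants
import Summits.BirchSwinnertonDyer.BirchSwinnertonDyer.Theorems.KimAtThreeKolyvaginInputs
import Summits.BirchSwinnertonDyer.Rank1Residual.GaloisImage.KatoKuriharaPortThreeWith
import Literature.NumberTheory.GaloisCohomology.Sakamoto2024KolyvaginFittingIdeal
import Literature.NumberTheory.GaloisCohomology.Sakamoto2024KolyvaginRankOne
import Literature.NumberTheory.GaloisCohomology.PoitouTateSelmerStructures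
import Summits.BirchSwinnertonDyer.Rank1Residual.GaloisImage.KatoExpStarFiniteLevel
import Summits.BirchSwinnertonDyer.Rank1Residual.Additive.PadicLogImage
import Literature.NumberTheory.EllipticCurves.PadicFormalLogOrder
import Summits.BirchSwinnertonDyer.BirchSwinnertonDyer.Theorems.KimAtThreeShallowEqDeepPositionDefs
import HarnessLib.Audit.Status.Attr

/-!
Route: KimAtThreeKolyvagin

# Route KimAtThreeKolyvagin — Kim's rank-0 Sha-length formula at p = 3 via Kolyvagin systems at
three

It suffices to show X = X₂ ∧ X₃ ∧ X₄ where, for E/ℚ with the 3-adic tower onto, Ш finite, newform f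
with 3-integral plus symbols and ord(δ̃) = 0 (analytic rank 0): X₂ (DeepLowerAtThree) = the
deep-limit LOWER inequality ∂^{(0)}(δ̃) ≤ ord₃ #Ш(3) + ∂^{(∞)}_deep(δ̃) (Mazur–Rubin rigidity for
the primitive Kolyvagin system of T₃E at p = 3); X₃ (DeepUpperAtThree) = the deep-limit UPPER
inequality (Kato's Euler system at an additive 3 as a Kolyvagin system, local lattice lemmas, the
dictionary x_n ↔ δ̃_n); X₄ (ShallowEqDeepAtTorsionFree) = under E(ℚ₃)[3] = 0 the shallow all-levels
infimum ∂^{(∞)} equals the deep limit (normalisation exponent e(Ω⁺_f) ≥ 0). X₂ ∧ X₃ is literally the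
cell's deep statement `N11.KimAtThreeDeepPUB` (proved equivalence `deepIff_holds` in the Sketch).
The leaf `N11.KimAtThreeRankZeroPUB` (rung W2; = Kim arXiv:2505.09121 Thm 1.1/1.2 at p = 3, rank 0,
t = 0, the kim3 CELL THEOREM) follows by antisymmetry in ℕ∞ and the tree lemma
`kuriharaPartialInfty_le_kuriharaPartialDeepInfty`.
Lean: `DeepLowerAtThree ∧ DeepUpperAtThree ∧ ShallowEqDeepAtTorsionFree`

## Assembly
Pure ℕ∞ arithmetic: cruxes 2 and 3 give d = d′ (Nat.cast injective) and ∂^{(0)} = ord₃ #Ш(3) + d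
with ∂^{(∞)}_deep = d; crux 4 with the tree lemma `kuriharaPartialInfty_le_kuriharaPartialDeepInfty`
gives ∂^{(∞)} = ∂^{(∞)}_deep = d; that is the leaf. Deciding theorem `closes` (glue.lean) =
`Theorems.KimAtThreeKolyvaginInputs.kimAtThreeRankZeroPUB_of_inputs h₁ h₂ h₃` (the Theorems-side
BRIDGE, director-bsd 2026-08-25T19:23:15Z pattern; the three inputs are spelled inline there and are
definitionally the three crux items) and concludes `N11.KimAtThreeRankZeroPUB` (D-0061
`--closes-target`).

CLOSES_TARGET: closes rung W2 of BirchSwinnertonDyer: Summit.BirchSwinnertonDyer.Rank1Residual.Additive.N11.KimAtThreeRankZeroPUB (D-0061; not the summit Statement) — the deciding theorem of this route concludes that registered leaf instead of the Statement decl `BirchSwinnertonDyer` (class rung: servable and labelled, never counted as concluding the summit Statement).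

Rationale: WHY THIS LINE. Kim 2025 (arXiv:2505.09121, unrefereed) extends the Kurihara-number structure theorem
of Kim2022StructureSelmer (AJM 148, p ≥ 5) to p = 3 by replacing Mazur–Rubin's hypothesis (H.4)/p ≥
5 with Sakamoto2024KolyvaginThree (JTNB 36: Thm 4.4, Cor 5.5 three-class Chebotarev, Thm 6.7
connectedness of the graph 𝒳⁰); the cell memo kim3/KIM3-PROOF.md (v2.4, referee PASS-FINAL,
REF-kim3.md) wrote this out at p = 3 for elliptic curves with the tower onto and located two p = 3
deviations from print (Kim 2026 Rem 3.8 / Lemma 3.10 false for Kodaira IV, IV*: the local lattice is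
3^{v₃(c₃)−t}ℤ₃). The route types the memo's architecture as three ledger cruxes in the tree's
∂-vocabulary (KuriharaNumberInvariants / KuriharaNumberDeepInvariants): rigidity (≥), Kato-side
bound (≤), shallow = deep at t = 0 (Lemma K: optimally normalised integral Kato system, Manin
constant c₀ ∈ ℤ by Edixhoven1991, e(Ω) = v₃(c₃) + v₃(c₀) + b ≥ 0). Imported areas: Euler/Kolyvagin
systems (MazurRubin2004, Kato2004Asterisque), modular symbols (Manin1972). What it does that no
prior route does: the BSD summit's routes (LeadingTerm, PAdicOrder, KatoTransfer …) never touch p =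
3 with additive reduction; the negatives index has no Kurihara-number statement; the tree holds the
leaf and its consumers (`bsdp_three_of_kimAtThreeRankZeroPUB_of_kuriharaUnitAt` etc.) but no
decomposition of the leaf itself.

RANKED CRUXES. #2 DeepLowerAtThree (crux) — For every E/ℚ (globally minimal W) with ρ_{E,3^n} onto
for all n, Ш(E/ℚ) finite, newform f with 3-integral plus symbols and ord(δ̃) = 0: the deep limit
∂^{(∞)}_deep(δ̃) is a natural number d and ∂^{(0)}(δ̃) ≤ ord₃ #Ш(E/ℚ)(3) + d — the rigidity half
(length Sel₀ ≥ ∂^{(0)}(κ⁰) for the primitive Kolyvagin system; memo §3 package P1–P9 at p = 3 with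
L-Cheb3 and Sakamoto Thm 6.7, §5 Steps 4–6). [difficulty: L] (why it might fail: Mazur–Rubin's Thm
4.5.6 / 5.2.12 equality at p = 3 rests on every "choose a useful prime" step needing ≤ 3
simultaneously non-zero classes (memo §3.2 audit) and on Sakamoto's Thm 6.7 hypotheses for (E[3^k],
F_can); one 4-class step or a residually non-cartesian F_can at an additive 3 breaks it.)
[Sakamoto2024KolyvaginThree, MazurRubin2004, Kim2025RefinedTNC, Kim2022StructureSelmer]
#3 DeepUpperAtThree (crux) — Same binders: ∂^{(∞)}_deep(δ̃) is a natural number d and ord₃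
#Ш(E/ℚ)(3) + d ≤ ∂^{(0)}(δ̃) — the Kato-side half: Kato's integral Euler system at 3 gives a
Kolyvagin system for (T₃E, F_can, 𝒫₁) whose classes are the naive derivative classes (memo §4.1), κ₁
≠ 0 from L(E,1) ≠ 0 (Kato's reciprocity law), the local lattice at an additive 3 is exp*_ω(H¹(ℚ₃,T))
= 3^{v₃(c₃)−t}ℤ₃ (Lemmas L/L′), and the moment-calculus dictionary 3^{v₃(c₃)}x_n ≡ U·δ̃_n (Prop
D_t); with KS(T₃E) free of rank one this yields length Ш[3^∞] ≤ ∂^{(0)} − ∂^{(∞)}_deep. [difficulty: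
L] (why it might fail: The dictionary needs Kato's value law at IMPRIMITIVE characters handled by
the moment calculus (print states it only up to Euler factors, memo §4.3 R1) and the lattice index
3^{v₃(c₃)−t} (Kim 2026 Rem 3.8 is false at p = 3 for types IV/IV*); a slip in either shifts ∂^{(0)}
by v₃(c₃).) [Kato2004Asterisque, Kim2022StructureSelmer, Kim2025RefinedTNC, MazurRubin2004]
#4 ShallowEqDeepAtTorsionFree (crux) — For every E/ℚ with the 3-adic tower onto, E(ℚ₃)[3] = 0, Ш
finite, newform f with 3-integral plus symbols and ord(δ̃) = 0: ∂^{(∞)}_deep(δ̃) ≤ ∂^{(∞)}(δ̃)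
(all-levels infimum), i.e. no shallow cyclic-level Kurihara number is less 3-divisible than the deep
limit; mechanism: δ̃_n = u⁻¹·3^{e}·x_n exactly at every level with e = e(Ω⁺_f) = v₃(c₃) + v₃(c₀) + b
≥ 0 for the optimally normalised integral Kato system (Lemma K, memo §17 / §4.4 (a″)), so ord₃ δ̃_n
≥ e + j₀ ≥ ∂^{(∞)}_deep. [difficulty: M] (why it might fail: FALSE at t ≥ 1 (memo §19: shallow
levels then carry Kim's p^t-formula, kit P2 tests); at t = 0 it needs e(Ω⁺_f) ≥ 0, i.e. that Kato's
optimal period sits BELOW Ω⁺_f — this uses c₀ ∈ ℤ (Edixhoven) for the strong Weil curve and the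
isogeny bookkeeping b ≥ 0, unverified in print at p = 3.) [Kim2025RefinedTNC, Edixhoven1991,
Manin1972, Kato2004Asterisque]

TWO-LAYER PLAN. DeepLowerAtThree ⇐ (KSPackageAtThree: the Mazur–Rubin package P1–P9 for (E[3^k],
F_can, 𝒫_k) under the tower — needs a Kolyvagin-system vocabulary in Literature first, definition
request D1) → (CoreVertexAttainment: Step 6, deep attainment at core vertices) → DeepLowerAtThree.
DeepUpperAtThree ⇐ (LocalLatticeAtThree: exp*_ω(H¹(ℚ₃,T₃E)) = 3^{v₃(c₃)−t}ℤ₃, typable over the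
tree's formal-group API) → (DictionaryD: 3^{v₃(c₃)}x_n ≡ U δ̃_n) → DeepUpperAtThree. Nothing filed
now.

KILL CRITERIA. A tower-onto, t = 0, rank-0 curve with a SHALLOW Kurihara number strictly less
3-divisible than ord₃(L(E,1)/Ω⁺_f) − ord₃ #Ш(3) refutes ShallowEqDeepAtTorsionFree and closes the
route refuted (the memo's P1/P2 kit tests found none on 12 + 30 curves); a refutation of
DeepLower/DeepUpper by a certified #Ш computation (3-descent) against ∂^{(0)} − ∂^{(∞)}_deep refutes
Kim's announced theorem itself. If Kim 2025 is refereed and formalised as a Literature fact, all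
three cruxes become `(h : Fact) →` restatements and the route is superseded.

NOT DECOMPOSED YET. The Kolyvagin-system layer is typed only at finite level: Literature HAS the
vocabulary (`Literature/NumberTheory/GaloisCohomology/KolyvaginSystems.lean`: `KolyvaginDatum`,
`IsKolyvaginSystem`, `kolyvaginSystems` = KS₁(T,𝓕) after MazurRubin2004 Def 3.1.3, `coreRank`,
`BlochKatoDatum.propagate`; `EllipticCurves/KummerSelmerStructure.lean`; Sakamoto 2024 Thm 4.4 typed
as `Sakamoto2024.kolyvaginSystems_freeRankOne_zmod_three_pow{,_at}`), but it LACKS the divisibility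
functionals ∂^{(r)}(κ), e_i(κ), ord κ, ∂^{(∞)} (MR04 Def 3.1.5 / 4.5.7 / 5.2.11), core vertices (Def
4.1.8) with the stub modules 𝓗′(n) (Def 4.3.1) and the graph 𝒳⁰ (Def 4.3.6) — definition request D1
(lit gen 10 is drafting it as `GaloisCohomology/KolyvaginSystemsDivisibility.lean`). Until D1 lands,
cruxes 2–3 are not split (their children KSPackageAtThree / CoreVertexAttainment /
LocalLatticeAtThree are named in the two-layer plan only); Lemma L/L′ and Prop D are layer-2
children of crux 3; the t ≥ 1 stratum (Theorem A-t, Cor C-t) is outside the leaf and deliberately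
not here.

RESIDUAL OF RECORD (2026-08-26T23:57:53Z; planner bsd-addord-plan g18 on director-bsd g5's «(β)
APPROVED — do it now» 2026-08-26T23:13:40Z, HOME/INBOX.md l.216; menu
HOME/planner/splitW2L/RESIDUAL-0828-draft.md §7; DOCSTRING-ONLY — zero structural change: no item
added, dropped, restated or resplit; statements and `closes` untouched; bc6 4/4/0 kept). STATE OF
THE KERNEL (Theorems landed 2026-08-26; referee wave 7a 12/12 PASS, HOME/REF-g30-checks.md §31–§42):
(a) KATO STRATUM — crux 3's child `KatoKuriharaPortThreeShared` (item 19560) ⟸ ⟨C1⟩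
`KatoFinePackageThree` ALONE (p471554
`KimAtThreeDeepUpperPortSharedOfFineKato.katoKuriharaPortThreeShared_of_fineKato`; (C2) = the
unramified conjunct of `Kato2004.ZetaBody` and (C3) = THEOREM D's bad-place clause are theorems —
w2-c3 g5 D-u chain, w2-acc4 p470337, kim3 g11 glue p469028 and
`KimAtThreeDeepUpperSplitGlueFineKatoU.kimAtThreeRankZeroPUB_of_pub_of_fineKato_of_deepUpperOff_of_residualOff`
p471828); ⟨C1⟩ = Kato's fine integral Euler system of T₃E at the additive prime 3 with the
Bloch–Kato dual-exponential normalisation exp*_ω (construction-shaped; text kernel-checked, kim3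
`lean-g11/C1Signature.lean`), tracked as definition item `defn-BlochKatoDualExponential` (--for
19560, filed 2026-08-26T22:54Z; cite facts to follow: Bloch–Kato 1990 Prop 3.8 / Ex 3.11, Kato 2004
Thm 9.7 ∘ 6.6(1)); equivalently 19560 ⟸ PORT@3-ALL (p474364
`KimAtThreeShallowEqDeepPortItem.katoKuriharaPortThreeShared_of_portAll`). (b) OFF THE STRATUM — the
family {19562 `DeepUpperAtThreeOffKatoStratum`, 19679 `DeepLowerAtThreeOffKatoStratum`, 19599
`ShallowEqDeepOffKatoStratum`, (R)_off `ResidualOffKatoStratum` (text w2-c4 g7 fb3f3b99d57e1fa2),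
TamDiv∞} collapses to ONE displayed port PORT@3-OFF (item text HOME/w2c4/PORT-OFF-SIGNATURE-g7.txt
fe90dcd763976cf7, decl-to-be `KatoKuriharaPortThreeOffStratum`, in the one-exponent
`GaloisImage.KatoKuriharaWitnessAt` currency, e = 0): 19599, 19077, 19562|t=0, 19679|t=0, (R)_off
and the LEAF ⟸ PUB ∧ PORT@3-OFF (+ alias 19678) by p473877 `KimAtThreeShallowEqDeepPortSeam` /
p474364 `…PortItem` (w2-c4 g7, memo HOME/w2c4/W2C4-PORTSEAM-g7.md 12a0382a3292b17d §3/§5; w2-acc6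
p472540, w2-acc1, w2-acc3 p475651 twins on the additive-defect rows); the t ≥ 1 additive-defect rows
of 19562 / 19679 lie outside the t = 0 leaf and keep the two-exponent PORT₂ / (R₁) displayed. HENCE
W2's residual of record = ONE debt class, the Kato–Kurihara port at 3 (K22-Thm3.13-PORT@3: Kato's
zeta elements ↦ Kurihara numbers with a level-independent exp*_ω exponent; Kim AJM 148 Thm 3.13 is
printed for p ≥ 5 with p ∤ c_p·c_P) — displayed as ⟨C1⟩ on the stratum and PORT@3-OFF off it, or as
the single text PORT@3-ALL (HOME/w2c4/PORT-ALL-SIGNATURE-g7.txt c0dc29d83e000985);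
dischargers-to-be: ★PK-6₂'s road
(`KimAtThreeShallowEqDeepPortOfZetaBody.katoKuriharaPortUnlocked_zero_of_zetaBody`, p475469:
ZetaBody + (P-EXP) riders + value rows, no reduction-type hypothesis at 3) and, at good /
multiplicative 3, definition item `defn-KatoKuriharaDictionaryThreeNonAddAt` (the non-unit Euler
factor E₃ moved into the normalisation). Why the port might fail: a LEVEL-DEPENDENT unit or exponent
in the value law at an anomalous good / split multiplicative / IV–IV* / 3 ∣ c_P prime 3 (Kim–Pollack
Rem 4.1) or a failure of the MazurRubin2004 App. A (33) bridge at p = 3 [Kim2022StructureSelmer Thm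
3.13, Lemma 3.3, 3.8; Kato2004Asterisque Thm 12.5; MazurRubin2004 Thm 3.2.4, App. A;
Kim2025RefinedTNC §4.2; Sakamoto2024KolyvaginThree]. TYPED UPGRADE (α), NOT executed here: file
PORT@3-OFF with closes (i) `(h19678 : KatoStratumSharedParts) (hOff :
KatoKuriharaPortThreeOffStratum)` :=
`KimAtThreeShallowEqDeepPortSeam.kimAtThreeRankZeroPUB_of_sharedParts_of_portOff
(KimAtThreeShallowEqDeepPortItem.portOff_of_portOffWitnessAt hOff) h19678`, or PORT@3-ALL with
closes (ii) over the four published leaves + hAll :=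
`KimAtThreeShallowEqDeepPortItem.kimAtThreeRankZeroPUB_of_pub_of_portAll` (both kernel-checked,
HOME/w2c4/lean-g7/Sketch_W2_closes_port.lean 13a2d4d30c4e3ca8) — only on a director word and only if
the gate's native preview keeps DeepLowerAtThree / DeepUpperAtThree / ShallowEqDeepAtTorsionFree in
the bc6 cone (else the parents are carried as binders). Nothing here is a claim of progress: it
fixes the list the 2026-08-28 (ε) clock reads.

CHEAPEST FALSIFIER. ShallowEqDeepAtTorsionFree on the kim3 STEP-0 pair and the P1 control set:
recompute δ̃_n at the first two cyclic levels for 5 tower ∧ t = 0 ∧ r0 curves with 3 ∤ c₃·c₀ and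
ord₃ #Ш(3) known by 3-descent (LMFDB), check min ord₃ δ̃_n ≥ ord₃(L(E,1)/Ω⁺_f) − ord₃ #Ш(3) (memo
§18 jobs j237723/j237751/j237748 already consistent); one violation kills crux 4.

NUMBERS. Locus: N11 / B3 rows of the cell = X4♯(3) ∩ r0 ∩ {3-adic tower onto} (book230: 759 X4 r0
cells at all p; the 3-adic tower sub-locus per cells/n1011 census); STEP-0 pair of record: kim3 memo
§8; P1 test: 12 curves with c₃ = 3 (all cyclic-level δ̃_n ≡ 0 mod 3^{k(n)}), P2: 30 curves.

DEFINITION REQUESTS. None open. D1 (the divisibility functionals ∂^{(r)}, e_i, ord, ∂^{(∞)} of a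
Kolyvagin system, core vertices, stub modules 𝓗′(n), graph 𝒳⁰ — MazurRubin2004 Def 3.1.5 / 4.1.8 /
4.3.1 / 4.3.6 / 4.5.7 / 5.2.11) LANDED as
`Literature/NumberTheory/GaloisCohomology/KolyvaginSystemsDivisibility.lean` (p407065,
bsd-addord-lit gen 10): `KolyvaginDatum.{kolyvaginVanishingOrder, kolyvaginPartial,
kolyvaginElementaryDivisor, kolyvaginPartialInfty, IsCoreVertex, stubSelmerGroup, IsStubSection,
IsPrimitive, coreGraph, IsCoreGraphConnected}`, consumed BY NAME by the two-layer plan; still absent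
(not needed to open): ℤ_p-coefficients KS̄(T) (Def 3.1.6) — the deep limit is taken as `lim_k` of
the level-k functional exactly as `KuriharaNumberDeepInvariants` does.

Novelty: Searches (2026-08-25): lean search 'KimAtThree' / 'kuriharaPartialDeep' (tree: leaf, deep leaf,
invariants; no route decl); ledger negatives BirchSwinnertonDyer (no Kurihara / p = 3 statement);
lit search "Kolyvagin system p = 3 Sakamoto" (corpus: Sakamoto2024KolyvaginThree held), lit search
--hybrid "structure of Selmer groups Kurihara numbers p=3"; lit galaxy search "Kurihara
number|Kolyvagin system" --star all.
Nearest prior art found: Kim2025RefinedTNC (arXiv:2505.09121) Thm 1.1/1.2 — the announced theorem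
itself; Sakamoto2024KolyvaginThree Thm 4.4/6.7 — the refereed p = 3 Kolyvagin-system input;
Kim2022StructureSelmer Thm 1.9 — the p ≥ 5 published version (tree fact
`Kim2026.rankZero_padicValNat_sha_le_of_maninConstant`).
Delta: first ledger decomposition of the p = 3 statement into the rigidity half, the Kato-side half
and the t = 0 shallow = deep normalisation statement, each typed in the tree's ∂-vocabulary with the
located p = 3 lattice correction built in.
Claimed grade: variant  [refs: 2505.09121]

Barriers (technique_class: kolyvagin-system, euler-system-kato, modular-symbols): - technique_class: kolyvagin-system, euler-system-kato, modular-symbols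
- Literature.Barriers.BirchSwinnertonDyer.TwoDescentDefectUnbounded: not in this class — the route
bounds ord₃ #Ш[3^∞] of ONE curve by Kurihara numbers of that curve (modular symbols of its own
newform), not by a descent defect uniform in a family; the barrier quantifies over families and does
not meet these cruxes.
- Literature.Barriers.BirchSwinnertonDyer.SelmerRankBarrier: inside-scope caveat only — every crux
carries the leaf's binder `Finite W.sha`, so the Selmer-versus-Mordell–Weil gap is closed by
hypothesis; the cruxes bound the 3-primary part of a finite Ш, which the barrier does not forbid.
- Literature.Barriers.BirchSwinnertonDyer.HeegnerPointBarrier: does not apply — the rows are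
analytic rank 0 (`kuriharaVanishingOrder W 3 f = 0`, L(E,1) ≠ 0) and no Heegner point is used; the
tribunal CLI's lexical t4 match (w = 7.1) is answered here.
- Literature.Barriers.BirchSwinnertonDyer.ExceptionalZeroBarrier /
PAdicFunctionalEquationSeesOnlyParity / PAdicHeightBarrier (Schneider1985_charGenerator_rankOne):
outside — no p-adic L-function and no p-adic height enter; Kurihara numbers are complex modular
symbols reduced mod 3^k and the bound is on the algebraic side (rank 0: no regulator).
- BC8 placement per crux: DeepLowerAtThree — outside every catalogued class; its real obstruction is
uncatalogued = Kolyvagin-system RIGIDITY at p = 3 (MR04 Thm 5.2.12 / Cor 5.2.13 printed under the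
running hypotheses in

History (route lifecycle, newest last):
- 2026-08-26T16:18:00Z · rev 9: informal re-worded for DeepUpperAtThreeOffKatoStratum (planner-bsd-addord-plan-g17-0)
- 2026-08-26T16:18:24Z · rev 10: informal re-worded for ShallowEqDeepOffKatoStratum (planner-bsd-addord-plan-g17-0)
- 2026-08-26T16:18:43Z · rev 11: informal re-worded for DeepLowerAtThreeOffKatoStratum (planner-bsd-addord-plan-g17-0)
- 2026-08-26T16:18:55Z · rev 12: informal re-worded for KatoKuriharaPortThreeShared (planner-bsd-addord-plan-g17-0)

sub-problem: BirchSwinnertonDyer · status: open · opened planner-bsd-addord-plan-g10-0 2026-08-25T21:09:46Z · rev 17 · ledger route-BirchSwinnertonDyer-KimAtThreeKolyvagin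
GENERATED by the gate from the ledger (D-0016/17). Provers cite these decls: `theorem foo : Summit.BirchSwinnertonDyer.BirchSwinnertonDyer.Theses.KimAtThreeKolyvagin.<Decl> := …` in Summits/BirchSwinnertonDyer/BirchSwinnertonDyer/Theorems/<Name>.lean.
-/

namespace Summit.BirchSwinnertonDyer.BirchSwinnertonDyer.Theses.KimAtThreeKolyvagin

open scoped BigOperators Topology Manifold Classical MeasureTheory ProbabilityTheory Matrix InnerProductSpace ComplexConjugate ContinuousMap
open Filter Set Function TopologicalSpace MeasureTheory

attribute [summit_statement] _root_.BirchSwinnertonDyer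
attribute [summit_statement] _root_.Summit.BirchSwinnertonDyer.Rank1Residual.Additive.N11.KimAtThreeRankZeroPUB

open Literature

/-- item stmt-BirchSwinnertonDyer-19075 · crux · rank 2 · SPLIT (gen 1) into KatoStratumSharedParts, DeepLowerAtThreeOffKatoStratum + glue DeepLowerOfParts · direct attempts still welcome (low priority) · by planner
why it might fail: Mazur–Rubin's Thm 4.5.6 / 5.2.12 equality at p = 3 rests on every "choose a useful prime" step needing ≤ 3 simultaneously non-zero classes (memo §3.2 audit) and on Sakamoto's Thm 6.7 hypotheses for (E[3^k], F_can); one 4-class step or a residually non-cartesian F_can at an additive 3 breaks it.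
sources: Sakamoto2024KolyvaginThree, MazurRubin2004, Kim2025RefinedTNC, Kim2022StructureSelmer
[crux] For every E/ℚ (globally minimal W) with ρ_{E,3^n} onto for all n, Ш(E/ℚ) finite, newform f
with 3-integral plus symbols and ord(δ̃) = 0: the deep limit ∂^{(∞)}_deep(δ̃) is a natural number d
and ∂^{(0)}(δ̃) ≤ ord₃ #Ш(E/ℚ)(3) + d — the rigidity half (length Sel₀ ≥ ∂^{(0)}(κ⁰) for the
primitive Kolyvagin system; memo §3 package P1–P9 at p = 3 with L-Cheb3 and Sakamoto Thm 6.7, §5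
Steps 4–6). [difficulty: L] -/
@[route_item "route-BirchSwinnertonDyer-KimAtThreeKolyvagin", crux]
def DeepLowerAtThree : Prop :=
  ∀ (W : WeierstrassCurve ℚ) [W.IsElliptic] [W.IsGloballyMinimal], (∀ n : ℕ, W.HasSurjectiveModNGaloisRep (3 ^ n : ℕ)) → Finite W.sha → ∀ {N : ℕ} [NeZero N] (f : CuspForm (CongruenceSubgroup.Gamma0 N) 2), Literature.NumberTheory.EllipticCurves.ModularForms.IsNewformOf W f → (∀ r : ℚ, Literature.NumberTheory.EllipticCurves.ratPlusSymbol f r ≠ 0 → 0 ≤ padicValRat 3 (Literature.NumberTheory.EllipticCurves.ratPlusSymbol f r)) → Literature.NumberTheory.EllipticCurves.kuriharaVanishingOrder W 3 f = 0 → ∃ d : ℕ, Literature.NumberTheory.EllipticCurves.kuriharaPartialDeepInfty W 3 f = d ∧ Literature.NumberTheory.EllipticCurves.kuriharaPartial W 3 f 0 ≤ ((padicValNat 3 (Nat.card (AddCommGroup.primaryComponent W.sha 3)) + d : ℕ) : ℕ∞)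

-- parent: DeepLowerAtThree · child (gen 1)
/--     item stmt-BirchSwinnertonDyer-19679 · crux · rank 202 · open
    parent: DeepLowerAtThree · by planner
    why it might fail: At 3 ∣ c₃ (IV/IV*) or E(ℚ₃)[3] ≠ 0 the Tamagawa/torsion factor can enter #Ш·Tam/… with the wrong sign for a LOWER bound on ∂^(0): a deep Kurihara number divisible by 3 from c₃ alone gives d ≥ 1 with ∂^(0) unchanged (Kim 2025 §8.1.2 Tamagawa-3 example shape).
    sources: Kim2025RefinedTNC, Kim2022StructureSelmer, Sakamoto2024, MazurRubin2004, Skinner2016PacificMC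
[crux · the parent DeepLowerAtThree RESTRICTED to the rows the end-of-ports road does NOT cover, in
kim3's optimal-datum-at-conductor currency; the `hOff` binder of w2-c2 g3's p441486
`KimAtThreeDeepLowerSplitGlue.deepLowerAtThree_of_parts` VERBATIM = item 19562's text with the final
inequality reversed] For a tower-surjective W₀ with Ш finite and a lattice-optimal, degree-minimal
parametrisation datum D₀ at N = conductor with 3-integral plus symbols and ord(δ̃) = 0, NOT on the
Kato stratum (additive at 3 ∧ 3 ∤ c₃ ∧ #E(ℚ₃)[3] = 1 ∧ 3 ∤ c_{D₀}): ∃ d, ∂^(∞)_deep = d ∧ ∂^(0) ≤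
ord₃ #Ш[3^∞] + d (the LOWER inequality). Sub-strata: good / multiplicative 3 with the tower onto
(w2-c2 g2 sockets KimAtThreeDeepLowerNonAdditiveRows / …OfAdditiveBranch: K1 leaf / YZ26 / Skinner16
BY NAME + Tamagawa divisibility of deep Kurihara numbers), IV/IV* (3 ∣ c₃), E(ℚ₃)[3] ≠ 0, 3 ∣ Manin
(⇒ 9 ∣ N). Owner w2-c2 (planner STATUS 2026-08-26T13:0xZ). STATE (2026-08-26; TARGET v6.37 E108
(b)): dictionary of record (tower row, t = 0; a = ∂^(0), d = ∂^(∞)_deep ≤ a, s = ord₃ #Ш[3^∞], c =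
v₃ ∏ c_ℓ): this decl = a ≤ s + d ⟸ Miller's LOWER half `MissingLowerBoundAt W 3` (a ≤ s + c, by name
on the K1 / YZ26 / Skinne -/
@[route_item "route-BirchSwinnertonDyer-KimAtThreeKolyvagin"]
def DeepLowerAtThreeOffKatoStratum : Prop :=
  ∀ (W₀ : WeierstrassCurve ℚ) [W₀.IsElliptic] [W₀.IsGloballyMinimal], (∀ n : ℕ, W₀.HasSurjectiveModNGaloisRep (3 ^ n : ℕ)) → Finite W₀.sha → ∀ {N : ℕ} [NeZero N], N = W₀.conductorNorm ℤ → ∀ (D₀ : Literature.NumberTheory.EllipticCurves.ModularForms.ModularParametrizationData W₀ N), (∀ z ∈ D₀.L.lattice, ∃ w ∈ Literature.NumberTheory.EllipticCurves.ModularForms.periodLattice D₀.f, z = D₀.c * w) → (∀ (W₂ : WeierstrassCurve ℚ) [W₂.IsElliptic] (D₂ : Literature.NumberTheory.EllipticCurves.ModularForms.ModularParametrizationData W₂ N), D₂.f = D₀.f → D₀.modularDegree ≤ D₂.modularDegree) → (∀ r : ℚ, Literature.NumberTheory.EllipticCurves.ratPlusSymbol D₀.f r ≠ 0 → 0 ≤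 padicValRat 3 (Literature.NumberTheory.EllipticCurves.ratPlusSymbol D₀.f r)) → Literature.NumberTheory.EllipticCurves.kuriharaVanishingOrder W₀ 3 D₀.f = 0 → ¬ ((haveI : Fact (Nat.Prime 3) := ⟨Nat.prime_three⟩; Literature.NumberTheory.EllipticCurves.Rank1Residual.Addv W₀ 3) ∧ ¬ 3 ∣ (W₀.baseChange ℚ_[3]).localTamagawaNumber ℤ_[3] ∧ Nat.card {Q : (W₀.baseChange ℚ_[3]).toAffine.Point // (3 : ℕ) • Q = 0} = 1 ∧ ¬ (3 : ℤ) ∣ D₀.maninConstant) → ∃ d : ℕ, Literature.NumberTheory.EllipticCurves.kuriharaPartialDeepInfty W₀ 3 D₀.f = d ∧ Literature.NumberTheory.EllipticCurves.kuriharaPartial W₀ 3 D₀.f 0 ≤ ((padicValNat 3 (Nat.card (AddCommGroup.primaryComponent W₀.sha 3)) + d : ℕ) : ℕ∞)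

-- parent: DeepLowerAtThree · child (gen 1)
/--     item stmt-BirchSwinnertonDyer-19678 · support · rank 201 · open
    parent: DeepLowerAtThree · by planner
[support · ALIAS CONJUNCTION, held] the FIVE no-stub shared parts of the §U split of
DeepUpperAtThree restated VERBATIM and joined by ∧ — SakamotoKolyvaginThree (19558) ∧
RankEqAnalyticRankLeOne (19921) ∧ PoitouTateSelmerDuality (19559) ∧ CarayolLevelEqConductor (19467)
∧ KatoKuriharaPortThreeShared (crux 19560) = conjuncts 1–5 of DeepUpperSplitSharedParts (19598)
without its stub conjunct (19561, off the critical path since p445255); exists only because a second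
parent cannot re-list a child of this route by name (gate: «child decl_name … already exists in this
route»); K1 precedent PrintedAndReadingFacts (19478), W2 precedent 19598. Never a proving target:
the work lives on 19560, the four leaves are published inputs by name. The same alias carries the
no-stub seams of 19076/19077 (p445255: KatoStratumSharedParts → DeepUpperAtThreeOffKatoStratum →
DeepUpperAtThree; → ShallowEqDeepOffKatoStratum → ShallowEqDeepAtTorsionFree; planner scratch
EnvW2L.lean). -/
@[route_item "route-BirchSwinnertonDyer-KimAtThreeKolyvagin", crux]
def KatoStratumSharedParts : Prop :=
  (Literature.NumberTheory.GaloisCohomology.Sakamoto2024.kolyvaginSystems_freeRankOne_zmod_three_pow ∧ Literature.NumberTheory.GaloisCohomology.Sakamoto2024.kolyvaginSystems_idealOfBasis_eq_fittingIdeal_zmod_three_pow) ∧ (Literature.NumberTheory.EllipticCurves.rank_eq_analyticRank_of_analyticRank_le_one) ∧ (Literature.NumberTheory.GaloisCohomology.poitouTate_selmerStructure_duality ℚ) ∧ (∀ (N : ℕ) [NeZero N], Literature.NumberTheory.EllipticCurves.ModularForms.IsNewformOf.level_eq_conductorNorm (N := N)) ∧ (∀ (W : WeierstrassCurve ℚ)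 [W.IsElliptic] [W.IsGloballyMinimal], (∀ m : ℕ, W.HasSurjectiveModNGaloisRep (3 ^ m : ℕ)) → (haveI : Fact (Nat.Prime 3) := ⟨Nat.prime_three⟩; Literature.NumberTheory.EllipticCurves.Rank1Residual.Addv W 3) → ¬ 3 ∣ (W.baseChange ℚ_[3]).localTamagawaNumber ℤ_[3] → Nat.card {Q : (W.baseChange ℚ_[3]).toAffine.Point // (3 : ℕ) • Q = 0} = 1 → ∀ (v₃ : IsDedekindDomain.HeightOneSpectrum (NumberField.RingOfIntegers ℚ)), ((3 : ℕ) : NumberField.RingOfIntegers ℚ) ∈ v₃.asIdeal → ∀ (η : (q : IsDedekindDomain.HeightOneSpectrum (NumberField.RingOfIntegers ℚ)) → (ZMod (Ideal.absNorm q.asIdeal))ˣ), (∀ q, Subgroup.zpowers (η q) = ⊤) → ∀ {N : ℕ} [NeZero N] (P : Literature.NumberTheory.EllipticCurves.ModularForms.ModularParametrizationData W N), N = W.conductorNorm ℤ → (∀ z ∈ P.L.lattice, ∃ w ∈ Literature.NumberTheory.EllipticCurves.ModularForms.periodLattice P.f, z = P.c * w) → ¬ (3 : ℤ) ∣ P.maninConstant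 → Summit.BirchSwinnertonDyer.Rank1Residual.GaloisImage.KatoKuriharaPortThreeAtWith₂ W 0 v₃ η P)

-- parent: DeepLowerAtThree · glue (gen 1)
/--     item stmt-BirchSwinnertonDyer-19680 · support · rank 203 · closed · proved by Summit.BirchSwinnertonDyer.BirchSwinnertonDyer.Theorems.KimAtThreeDeepLowerSplitGlueItem.deepLowerOfParts_proof (prover)
    parent: DeepLowerAtThree · GLUE: children ⟹ parent · by planner
§L glue (k = 2): KatoStratumSharedParts → DeepLowerAtThreeOffKatoStratum → DeepLowerAtThree. PROVED
in the planner scratch HOME/planner/splitW2L/EnvW2L.lean (`deepLowerOfParts_proof`, rc 0, 0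
sorries): destructure the five-part alias (Sakamoto ×2, GZK, Poitou–Tate, Carayol, PORT″) and apply
w2-c2 g3's p441486 `KimAtThreeDeepLowerSplitGlue.deepLowerAtThree_of_parts hSak hGZK hPT hlev hPort
hOff` (ON the Kato stratum: `deepLower_optimal_of_ports_of_poitouTate` at a constructed place v₃ ∣ 3
and generator family η; OFF it: the crux verbatim). A W2 hand (w2-c2) lands it as
Theorems/KimAtThreeDeepLowerSplitGlueItem.lean --workitem <this glue item>. -/
@[route_item "route-BirchSwinnertonDyer-KimAtThreeKolyvagin"]
def DeepLowerOfParts : Prop :=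
  KatoStratumSharedParts → DeepLowerAtThreeOffKatoStratum → DeepLowerAtThree

-- `DeepLowerOfParts` holds: proved by `Summit.BirchSwinnertonDyer.BirchSwinnertonDyer.Theorems.KimAtThreeDeepLowerSplitGlueItem.deepLowerOfParts_proof` (its module imports this route file, so no `_holds` link can be stated here).

/-- item stmt-BirchSwinnertonDyer-19076 · crux · rank 3 · SPLIT (gen 1) into SakamotoKolyvaginThree, RankEqAnalyticRankLeOne, PoitouTateSelmerDuality, CarayolLevelEqConductor, KatoKuriharaPortThreeShared, StubAtEmptyLevelThree, DeepUpperAtThreeOffKatoStratum + glue DeepUpperAtThreeOfParts · direct attempts still welcome (low priority) · by planner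
why it might fail: The dictionary needs Kato's value law at IMPRIMITIVE characters handled by the moment calculus (print states it only up to Euler factors, memo §4.3 R1) and the lattice index 3^{v₃(c₃)−t} (Kim 2026 Rem 3.8 is false at p = 3 for types IV/IV*); a slip in either shifts ∂^{(0)} by v₃(c₃).
sources: Kato2004Asterisque, Kim2022StructureSelmer, Kim2025RefinedTNC, MazurRubin2004
[crux] Same binders: ∂^{(∞)}_deep(δ̃) is a natural number d and ord₃ #Ш(E/ℚ)(3) + d ≤ ∂^{(0)}(δ̃) —
the Kato-side half: Kato's integral Euler system at 3 gives a Kolyvagin system for (T₃E, F_can, 𝒫₁)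
whose classes are the naive derivative classes (memo §4.1), κ₁ ≠ 0 from L(E,1) ≠ 0 (Kato's
reciprocity law), the local lattice at an additive 3 is exp*_ω(H¹(ℚ₃,T)) = 3^{v₃(c₃)−t}ℤ₃ (Lemmas
L/L′), and the moment-calculus dictionary 3^{v₃(c₃)}x_n ≡ U·δ̃_n (Prop D_t); with KS(T₃E) free of
rank one this yields length Ш[3^∞] ≤ ∂^{(0)} − ∂^{(∞)}_deep. [difficulty: L] -/
@[route_item "route-BirchSwinnertonDyer-KimAtThreeKolyvagin", crux]
def DeepUpperAtThree : Prop :=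
  ∀ (W : WeierstrassCurve ℚ) [W.IsElliptic] [W.IsGloballyMinimal], (∀ n : ℕ, W.HasSurjectiveModNGaloisRep (3 ^ n : ℕ)) → Finite W.sha → ∀ {N : ℕ} [NeZero N] (f : CuspForm (CongruenceSubgroup.Gamma0 N) 2), Literature.NumberTheory.EllipticCurves.ModularForms.IsNewformOf W f → (∀ r : ℚ, Literature.NumberTheory.EllipticCurves.ratPlusSymbol f r ≠ 0 → 0 ≤ padicValRat 3 (Literature.NumberTheory.EllipticCurves.ratPlusSymbol f r)) → Literature.NumberTheory.EllipticCurves.kuriharaVanishingOrder W 3 f = 0 → ∃ d : ℕ, Literature.NumberTheory.EllipticCurves.kuriharaPartialDeepInfty W 3 f = d ∧ ((padicValNat 3 (Nat.card (AddCommGroup.primaryComponent W.sha 3)) + d : ℕ) : ℕ∞) ≤ Literature.NumberTheory.EllipticCurves.kuriharaPartial W 3 f 0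

-- parent: DeepUpperAtThree · child (gen 1)
/--     item stmt-BirchSwinnertonDyer-19560 · crux · rank 305 · open
    parent: DeepUpperAtThree · by planner
    why it might fail: Kato's value law is printed only up to Euler factors at imprimitive characters and the additive-3 lattice index 3^{v₃(c₃)−t} (Kim 2026 Rem 3.8 false at p = 3 for IV/IV*); a sign/unit slip in the two-level (COMP) clause is what killed the universal-η PORT (FLAG K22-Thm3.13-PORT@3).
    sources: Kim2022StructureSelmer, Kato2004Asterisque, MazurRubin2004, Sakamoto2024
[crux · the declared PORT of the 19075/19076 Kato stratum, now an item] The shared-generator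
Kato–Kurihara dictionary PORT″ `KatoKuriharaPortThreeAtWith₂ W 0 v₃ η P` (FLAG K22-Thm3.13-PORT@3:
Kim AJM 148 (2026) Thm 3.13 / Thm 1.9(6) read at p = 3 — NOT in print at 3) for a tower-surjective W
ADDITIVE at 3 with 3 ∤ c₃ and E(ℚ₃)[3] = 0, one generator family η of the (ℤ/q)ˣ, at a
lattice-optimal parametrisation datum P of CONDUCTOR level with 3 ∤ Manin constant: for all depths
k, k′ and canonical τ-data D, D′ for the SAME η, the P-keyed two-level dictionary (Kato's
zeta-element Kolyvagin system ↔ Kurihara numbers, 3^{v₃(c₃)}x_n ≡ U·δ̃_n). The universal-η PORT is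
kernel-REFUTED (n1011-p11 `KatoKuriharaPortThreeRefutation`: η vs η⁻¹ sign mechanism); the shared-η
PORT″ is untouched by that witness and has a NAMED DISCHARGER ★PK-6₂ from `ZetaBody W 3 P.f` at N =
conductor (GaloisImage/KatoKuriharaPortThreeWith docstring; lead R5-112(a)). Binder hPort of
`deepUpper_optimal_of_ports_of_towerSurj`. STATE (2026-08-26, kim3 g10; TARGET v6.37 E108 (c)):
registered skeleton `Cruxes/KatoKuriharaPortThreeShared/Lines/birth.lean` (`stub_oneLevel` /
`stub_descend`); landed p448445 `Theorems/KimAtThr -/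
@[route_item "route-BirchSwinnertonDyer-KimAtThreeKolyvagin"]
def KatoKuriharaPortThreeShared : Prop :=
  ∀ (W : WeierstrassCurve ℚ) [W.IsElliptic] [W.IsGloballyMinimal], (∀ m : ℕ, W.HasSurjectiveModNGaloisRep (3 ^ m : ℕ)) → (haveI : Fact (Nat.Prime 3) := ⟨Nat.prime_three⟩; Literature.NumberTheory.EllipticCurves.Rank1Residual.Addv W 3) → ¬ 3 ∣ (W.baseChange ℚ_[3]).localTamagawaNumber ℤ_[3] → Nat.card {Q : (W.baseChange ℚ_[3]).toAffine.Point // (3 : ℕ) • Q = 0} = 1 → ∀ (v₃ : IsDedekindDomain.HeightOneSpectrum (NumberField.RingOfIntegers ℚ)), ((3 : ℕ) : NumberField.RingOfIntegers ℚ) ∈ v₃.asIdeal → ∀ (η : (q : IsDedekindDomain.HeightOneSpectrum (NumberField.RingOfIntegers ℚ)) → (ZMod (Ideal.absNorm q.asIdeal))ˣ), (∀ q, Subgroup.zpowers (η q) = ⊤) → ∀ {N : ℕ} [NeZero N] (P : Literature.NumberTheory.EllipticCurves.ModularForms.ModularParametrizationData W N), N = W.conductorNorm ℤ → (∀ z ∈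 P.L.lattice, ∃ w ∈ Literature.NumberTheory.EllipticCurves.ModularForms.periodLattice P.f, z = P.c * w) → ¬ (3 : ℤ) ∣ P.maninConstant → Summit.BirchSwinnertonDyer.Rank1Residual.GaloisImage.KatoKuriharaPortThreeAtWith₂ W 0 v₃ η P

-- parent: DeepUpperAtThree · child (gen 1)
/--     item stmt-BirchSwinnertonDyer-19562 · crux · rank 307 · open
    parent: DeepUpperAtThree · by planner
    why it might fail: At good anomalous 3 / split multiplicative 3 the Kurihara numbers acquire the factor (1 − a₃⁻¹)² / the 𝓛-invariant and Kim's dictionary shifts ∂^{(0)} by its valuation; at E(ℚ₃)[3] ≠ 0 the lattice index 3^{v₃(c₃)−t} can put the inequality off by t (kim3 P2 kit tests).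
    sources: Kim2025RefinedTNC, Kim2022StructureSelmer, Kato2004Asterisque, YanZhu2026, Skinner2016PacificMC
[crux · the parent RESTRICTED to the rows the end-of-ports road does NOT cover, in kim3's
optimal-datum-at-conductor currency] For a tower-surjective W₀ with Ш finite and a lattice-optimal,
degree-minimal parametrisation datum D₀ at N = conductor with 3-integral plus symbols and ord(δ̃) =
0, whose row is NOT (additive at 3 ∧ 3 ∤ c₃ ∧ E(ℚ₃)[3] = 0 ∧ 3 ∤ c_{D₀}): ∂^{(∞)}_deep(δ̃) = d ∈ ℕ
and ord₃ #Ш(3) + d ≤ ∂^{(0)}(δ̃). Population: good ordinary / good supersingular / multiplicative 3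
with the 3-adic tower onto, additive IV/IV* (3 ∣ c₃: two-exponent port), E(ℚ₃)[3] ≠ 0, and 3 ∣ Manin
constant of the optimal curve (possible only if 9 ∣ N, Mazur 1978 / Edixhoven 1991). Roads in print:
Kim 2025 Thm 1.1 is stated for these rows too but its §5 proof is the same Kato-KS argument with
Euler factors E_ℓ(σ) mixing δ̃_n and δ̃_{n/ℓ} at good/multiplicative 3 (w2-c4 domain audit 05:21Z);
w2-c2's `KimAtThreeDeepLowerNonAdditiveRows` pattern (YZ26 / Skinner16 by name) is the model for a
by-name discharge of sub-strata. STATE (2026-08-26, w2-c5 DONE; tenure reading of record, TARGET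
v6.37 E108 (d)): landed `--supports` helpers p450990 `Theorems/KimAtThreeDeepUpperNonAdditiveRows` ·
p452256 `…DeepU -/
@[route_item "route-BirchSwinnertonDyer-KimAtThreeKolyvagin", crux]
def DeepUpperAtThreeOffKatoStratum : Prop :=
  ∀ (W₀ : WeierstrassCurve ℚ) [W₀.IsElliptic] [W₀.IsGloballyMinimal], (∀ n : ℕ, W₀.HasSurjectiveModNGaloisRep (3 ^ n : ℕ)) → Finite W₀.sha → ∀ {N : ℕ} [NeZero N], N = W₀.conductorNorm ℤ → ∀ (D₀ : Literature.NumberTheory.EllipticCurves.ModularForms.ModularParametrizationData W₀ N), (∀ z ∈ D₀.L.lattice, ∃ w ∈ Literature.NumberTheory.EllipticCurves.ModularForms.periodLattice D₀.f, z = D₀.c * w) → (∀ (W₂ : WeierstrassCurve ℚ) [W₂.IsElliptic] (D₂ : Literature.NumberTheory.EllipticCurves.ModularForms.ModularParametrizationData W₂ N), D₂.f = D₀.f → D₀.modularDegree ≤ D₂.modularDegree) → (∀ r : ℚ, Literature.NumberTheory.EllipticCurves.ratPlusSymbol D₀.f r ≠ 0 → 0 ≤ padicValRat 3 (Literature.NumberTheory.EllipticCurves.ratPlusSymbol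 D₀.f r)) → Literature.NumberTheory.EllipticCurves.kuriharaVanishingOrder W₀ 3 D₀.f = 0 → ¬ ((haveI : Fact (Nat.Prime 3) := ⟨Nat.prime_three⟩; Literature.NumberTheory.EllipticCurves.Rank1Residual.Addv W₀ 3) ∧ ¬ 3 ∣ (W₀.baseChange ℚ_[3]).localTamagawaNumber ℤ_[3] ∧ Nat.card {Q : (W₀.baseChange ℚ_[3]).toAffine.Point // (3 : ℕ) • Q = 0} = 1 ∧ ¬ (3 : ℤ) ∣ D₀.maninConstant) → ∃ d : ℕ, Literature.NumberTheory.EllipticCurves.kuriharaPartialDeepInfty W₀ 3 D₀.f = d ∧ ((padicValNat 3 (Nat.card (AddCommGroup.primaryComponent W₀.sha 3)) + d : ℕ) : ℕ∞) ≤ Literature.NumberTheory.EllipticCurves.kuriharaPartial W₀ 3 D₀.f 0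

-- parent: DeepUpperAtThree · child (gen 1)
/--     item stmt-BirchSwinnertonDyer-19558 · support · rank 301 · open
    parent: DeepUpperAtThree · by planner
[support · cite_only leaf, HELD at birth] Sakamoto 2024 (JTNB 36) Thm 4.4 (KS(T,𝓕,𝒫) free of rank
one over ℤ/3^k under (H.0)–(H.4) for p = 3) ∧ its Fitting-ideal clause (Thm 4.4 / MR04 Thm 4.4.1
shape), the tree's two named PUB facts stated BY NAME; binders hS24/hS24₂ of w2-c3's
`KimAtThreeDeepUpperOfPortsDevissage.deepUpper_optimal_of_ports_of_towerSurj` (p432628 + Devissage).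
Never provable in-tree as new mathematics; closes only by a Literature `_holds`. [cite:
Sakamoto2024, Thm. 4.4 (p. 926), Def. 3.5] -/
@[route_item "route-BirchSwinnertonDyer-KimAtThreeKolyvagin", crux]
def SakamotoKolyvaginThree : Prop :=
  Literature.NumberTheory.GaloisCohomology.Sakamoto2024.kolyvaginSystems_freeRankOne_zmod_three_pow ∧ Literature.NumberTheory.GaloisCohomology.Sakamoto2024.kolyvaginSystems_idealOfBasis_eq_fittingIdeal_zmod_three_pow

-- parent: DeepUpperAtThree · child (gen 1)
/--     item stmt-BirchSwinnertonDyer-19921 · support · rank 302 · open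
    parent: DeepUpperAtThree · by operator
[support] The one PUBLISHED input the halves-glue consumes: Gross–Zagier–Kolyvagin, rank = analytic
rank for analytic rank ≤ 1 with Ш finite (tree named fact
rank_eq_analyticRank_of_analyticRank_le_one; used by bsdp_of_missingPPartAt to turn Miller's last
clause into BSD(E,2)). Carried as a displayed PUB hypothesis; never counted as progress. The further
PRINT of the roads to the two halves (Greenberg Thm-4.1 analogues at a multiplicative prime
thm41Analogue_charValue_rankZero_numberField_anyPrime / …_split_baseChange_anyPrime, modularity) and
the referee-passed MEMO inputs (Kato ⊗ℚ at a multiplicative 2: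
X5.O1.KatoMultiplicativeDivisibilityRat W 2, HOME mult/PROOF-MULT.md RC-2; Greenberg–Stevens at 2:
greenberg_stevens W 2, mult/PROOF-GS2.md RC-4) enter the LINES under the halves (bridge
multiplicativeRankZeroAtTwo_of_muRoad, p409679), not this glue. -/
@[route_item "route-BirchSwinnertonDyer-KimAtThreeKolyvagin", crux]
def RankEqAnalyticRankLeOne : Prop :=
  Literature.NumberTheory.EllipticCurves.rank_eq_analyticRank_of_analyticRank_le_one

-- parent: DeepUpperAtThree · child (gen 1)
/--     item stmt-BirchSwinnertonDyer-19559 · support · rank 303 · open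
    parent: DeepUpperAtThree · by planner
[support · cite_only leaf, HELD at birth] Poitou–Tate duality for Selmer structures over ℚ (Milne
ADT I Thm 4.10(b), Howard 2004 Thm 2.1.11, MR04 Thm 2.3.4): for every n ≥ 1 a family of local
invariants with IsPerfect ∧ SumLocalTermEqZero ∧ UnramifiedOrthogonal ∧ SelmerComplement — the
tree's named PUB fact `poitouTate_selmerStructure_duality ℚ` BY NAME; it PRODUCES the binders
inv/hperf/hsum/hcompl and the family inv′ k′ (+ hinj′ from IsPerfect) of the end-of-ports theorem.
[cite: MilneADT2006, Ch. I, Thm. 4.10(b)] [cite: Howard2004HeegnerKolyvagin, Thm. 2.1.11] -/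
@[route_item "route-BirchSwinnertonDyer-KimAtThreeKolyvagin", crux]
def PoitouTateSelmerDuality : Prop :=
  Literature.NumberTheory.GaloisCohomology.poitouTate_selmerStructure_duality ℚ

-- parent: DeepUpperAtThree · child (gen 1)
/--     item stmt-BirchSwinnertonDyer-19467 · support · rank 304 · open
    parent: DeepUpperAtThree · by planner
[aside] Carayol 1986 (Ann. Sci. ÉNS 19; Diamond–Shurman Thm 8.8.1): if f ∈ S₂(Γ₀(N)) is the newform
of E then N = N_E — the ∀-closure over the level N of the tree's named fact
`IsNewformOf.level_eq_conductorNorm` (its N is a section variable), verbatim the last conjunct of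
both layer-2 inputs items. Banked context (D-0019 aside): never staffed, not progress; filed so the
cite-only constant, which sits inside the layer-2 cite-only inputs item(s) MuTransferInputs
(stmt-BirchSwinnertonDyer-19277) and MuSplitInputs (stmt-BirchSwinnertonDyer-19236) (a split child
cannot be split again — two layers only), is item-stated BY NAME (readiness rule 2026-08-15 / gate5
#15c; K3 precedent route-BirchSwinnertonDyer-SignedLowerHalves rev 4). No crux statement / closes /
tribunal / tribunal_fit change. -/
@[route_item "route-BirchSwinnertonDyer-KimAtThreeKolyvagin", crux]
def CarayolLevelEqConductor : Prop :=
  ∀ (N : ℕ) [NeZero N], Literature.NumberTheory.EllipticCurves.ModularForms.IsNewformOf.level_eq_conductorNorm (N := N)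

-- parent: DeepUpperAtThree · child (gen 1)
/--     item stmt-BirchSwinnertonDyer-19561 · aside · rank 306 · open
    parent: DeepUpperAtThree · by planner
    why it might fail: MR04 Thm 4.3.4 needs (H.6) and 'useful prime' choices printed for p ≥ 5; at p = 3 the induction on stub exponents must be re-run with Sakamoto's Cor 5.5 prime choice, and the Kummer part m may fail to split off when 𝓕_can ≠ 𝓚 at the additive 3.
    sources: MazurRubin2004, Rubin2011PCMI, Sakamoto2024, Kim2025RefinedTNC
[crux · binder hStub of w2-c3's end-of-ports theorem VERBATIM, closed over W (tower-surjective) and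
the generator family η] STUB AT THE EMPTY LEVEL for general m: for every depth k, every τ-datum Dk
canonical for η, every ℕ-generator g of KS(E[3^{k+1}], 𝓕_can, 𝒫) and n₀ with
#H¹_{𝓕_can}(ℚ,E[3^{k+1}]) = 3^{k+1}·3^{n₀}: g(∅) = 3^{n₀}•e + m with e ∈ H¹_{𝓕_can} and m ∈ H¹_𝓚
(Kummer) — Mazur–Rubin 2004 Thm 4.3.4 / Cor 4.3.5 (λ(∅) = length of the dual Selmer group; Rubin
PCMI 2011 Thm 2.8.4 sketch at m = 1, Cor 2.6.2(3) printed in full) transported to p = 3 under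
Sakamoto's hypotheses; n1011 has the m = 1 case only (`KolyvaginStubVanishing`). MR04 §4.3 text:
acq-09798 / acq-02261 OPEN (ref g27: the hStub print basis p0047 Thm 4.3.4/Cor 4.3.5 + Cor 4.5.2 is
page-checked in the held MR04 dossier). -/
@[route_item "route-BirchSwinnertonDyer-KimAtThreeKolyvagin"]
def StubAtEmptyLevelThree : Prop :=
  ∀ (W : WeierstrassCurve ℚ) [W.IsElliptic] [W.IsGloballyMinimal], (∀ m : ℕ, W.HasSurjectiveModNGaloisRep (3 ^ m : ℕ)) → ∀ (η : (q : IsDedekindDomain.HeightOneSpectrum (NumberField.RingOfIntegers ℚ)) → (ZMod (Ideal.absNorm q.asIdeal))ˣ), (∀ q, Subgroup.zpowers (η q) = ⊤) → ∀ (k : ℕ) (Dk : Literature.NumberTheory.GaloisCohomology.KolyvaginDatum (W.torsionGaloisModule (((3 : ℕ) : ℤ) ^ k * ((3 : ℕ) : ℤ)))) (g : Finset (IsDedekindDomain.HeightOneSpectrum (NumberField.RingOfIntegers ℚ)) → Literature.NumberTheory.GaloisRepresentations.galoisCohomology (W.torsionGaloisModule (((3 : ℕ) : ℤ) ^ k *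 ((3 : ℕ) : ℤ))) 1) (n₀ : ℕ), Dk.IsCanonicalTauDatumThreeAtWith W k k η → g ∈ Dk.kolyvaginSystems (Summit.BirchSwinnertonDyer.Rank1Residual.GaloisImage.propagatedSelmerStructure W 3 k) → (∀ κ ∈ Dk.kolyvaginSystems (Summit.BirchSwinnertonDyer.Rank1Residual.GaloisImage.propagatedSelmerStructure W 3 k), ∃ a : ℕ, κ = a • g) → Nat.card (Summit.BirchSwinnertonDyer.Rank1Residual.GaloisImage.propagatedSelmerStructure W 3 k).selmerGroup = 3 ^ (k + 1) * 3 ^ n₀ → ∃ e ∈ (Summit.BirchSwinnertonDyer.Rank1Residual.GaloisImage.propagatedSelmerStructure W 3 k).selmerGroup, ∃ m ∈ (W.kummerSelmerStructure (((3 : ℕ) : ℤ) ^ k * ((3 : ℕ) : ℤ))).selmerGroup, g ∅ = 3 ^ n₀ • e + m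

-- parent: DeepUpperAtThree · glue (gen 1)
/--     item stmt-BirchSwinnertonDyer-19563 · support · rank 308 · closed · proved by Summit.BirchSwinnertonDyer.BirchSwinnertonDyer.Theorems.KimAtThreeDeepUpperSplitGlue.deepUpperAtThreeOfParts_proof (prover)
    parent: DeepUpperAtThree · GLUE: children ⟹ parent · by planner
end-of-ports seam, ALREADY KERNEL-CHECKED (planner EnvW2.lean rc 0, theorem
deepUpperAtThreeOfParts_proof, no sorry): the children are the binders of w2-c3's landed
Theorems.KimAtThreeDeepUpperOfPortsDevissage.deepUpper_optimal_of_ports_of_towerSurj (p431940 /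
p432628 / p433736) composed with kim3's
Theorems.KimAtThreeKolyvaginIsogenyCruxes.deepUpperAtThree_of_forall_optimalDatum_atConductor
(isogeny transport to the lattice-optimal, degree-minimal datum at N = conductor, Carayol): 4 HELD
by-name published inputs (Sakamoto 2024 Thm 4.4 + Fitting clause at p = 3; Gross-Zagier-Kolyvagin
rank part; Poitou-Tate duality for Selmer structures over Q; Carayol level = conductor) -> the
shared-generator Kato-Kurihara PORT'' at t = 0 on the Kato stratum (FLAG K22-Thm3.13-PORT@3,
item-stated; the universal-generator PORT is kernel-refuted, this one is not) -> the STUB at the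
empty level for the generator of KS(E[3^{k+1}], F_can) at general m (Mazur-Rubin 2004 Thm 4.4.1 /
4.3.4 at p = 3; binder hStub verbatim) -> DeepUpperAtThree OFF the Kato stratum (good /
multiplicative 3, IV/IV*, E(Q_3)[3] != 0, 3 | Manin constant; the parent restricted, in kim3's
optimal-datum-at-conductor currency) => De -/
@[route_item "route-BirchSwinnertonDyer-KimAtThreeKolyvagin"]
def DeepUpperAtThreeOfParts : Prop :=
  SakamotoKolyvaginThree → RankEqAnalyticRankLeOne → PoitouTateSelmerDuality → CarayolLevelEqConductor → KatoKuriharaPortThreeShared → StubAtEmptyLevelThree → DeepUpperAtThreeOffKatoStratum → DeepUpperAtThree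

-- `DeepUpperAtThreeOfParts` holds: proved by `Summit.BirchSwinnertonDyer.BirchSwinnertonDyer.Theorems.KimAtThreeDeepUpperSplitGlue.deepUpperAtThreeOfParts_proof` (its module imports this route file, so no `_holds` link can be stated here).

/-- item stmt-BirchSwinnertonDyer-19077 · crux · rank 4 · SPLIT (gen 1) into DeepUpperSplitSharedParts, ShallowEqDeepOffKatoStratum + glue ShallowEqDeepOfParts · direct attempts still welcome (low priority) · by planner
why it might fail: FALSE at t ≥ 1 (memo §19: shallow levels then carry Kim's p^t-formula, kit P2 tests); at t = 0 it needs e(Ω⁺_f) ≥ 0, i.e. that Kato's optimal period sits BELOW Ω⁺_f — this uses c₀ ∈ ℤ (Edixhoven) for the strong Weil curve and the isogeny bookkeeping b ≥ 0, unverified in print at p = 3.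
sources: Kim2025RefinedTNC, Edixhoven1991, Manin1972, Kato2004Asterisque
[crux] For every E/ℚ with the 3-adic tower onto, E(ℚ₃)[3] = 0, Ш finite, newform f with 3-integral
plus symbols and ord(δ̃) = 0: ∂^{(∞)}_deep(δ̃) ≤ ∂^{(∞)}(δ̃) (all-levels infimum), i.e. no shallow
cyclic-level Kurihara number is less 3-divisible than the deep limit; mechanism: δ̃_n =
u⁻¹·3^{e}·x_n exactly at every level with e = e(Ω⁺_f) = v₃(c₃) + v₃(c₀) + b ≥ 0 for the optimally
normalised integral Kato system (Lemma K, memo §17 / §4.4 (a″)), so ord₃ δ̃_n ≥ e + j₀ ≥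
∂^{(∞)}_deep. [difficulty: M] -/
@[route_item "route-BirchSwinnertonDyer-KimAtThreeKolyvagin", crux]
def ShallowEqDeepAtTorsionFree : Prop :=
  ∀ (W : WeierstrassCurve ℚ) [W.IsElliptic] [W.IsGloballyMinimal], (∀ n : ℕ, W.HasSurjectiveModNGaloisRep (3 ^ n : ℕ)) → Nat.card {Q : (W.baseChange ℚ_[3]).toAffine.Point // (3 : ℕ) • Q = 0} = 1 → Finite W.sha → ∀ {N : ℕ} [NeZero N] (f : CuspForm (CongruenceSubgroup.Gamma0 N) 2), Literature.NumberTheory.EllipticCurves.ModularForms.IsNewformOf W f → (∀ r : ℚ, Literature.NumberTheory.EllipticCurves.ratPlusSymbol f r ≠ 0 → 0 ≤ padicValRat 3 (Literature.NumberTheory.EllipticCurves.ratPlusSymbol f r)) → Literature.NumberTheory.EllipticCurves.kuriharaVanishingOrder W 3 f = 0 → Literature.NumberTheory.EllipticCurves.kuriharaPartialDeepInfty W 3 f ≤ Literature.NumberTheory.EllipticCurves.kuriharaPartialInfty W 3 f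

-- parent: ShallowEqDeepAtTorsionFree · child (gen 1)
/--     item stmt-BirchSwinnertonDyer-19599 · crux · rank 402 · open
    parent: ShallowEqDeepAtTorsionFree · by planner
    why it might fail: At good anomalous or split multiplicative 3 a SHALLOW unit Kurihara number can occur at a level with primes ≢ 1 mod 9 while every deep δ̃_n is a non-unit (kim3 P2 kit test shape; Kim 2025 §8.1.2's Tamagawa-3 example is a shallow/deep discrepancy at t ≥ 1).
    sources: Kim2025RefinedTNC, Kim2022StructureSelmer, Sakamoto2024, MazurRubin2004
[crux · the parent RESTRICTED to the rows the end-of-ports road does NOT cover, in kim3's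
optimal-datum-at-conductor currency] For a tower-surjective W₀ with E(ℚ₃)[3] = 0 and Ш finite and a
lattice-optimal, degree-minimal parametrisation datum D₀ at N = conductor with 3-integral plus
symbols and ord(δ̃) = 0, whose row is NOT (additive at 3 ∧ 3 ∤ c₃ ∧ 3 ∤ c_{D₀}): ∂^{(∞)}_deep(δ̃) ≤
∂^{(∞)}(δ̃) (SHALLOW = DEEP). Population: good ordinary / good supersingular / multiplicative 3 with
the 3-adic tower onto, additive IV/IV* (3 ∣ c₃), 3 ∣ Manin constant of the optimal curve. On the
Kato stratum the statement is w2-c3's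
`KimAtThreeDeepUpperOfPortsClasswide.shallowEqDeep_conclusion_classwide_of_ports_of_stub` (p435413)
from the SAME inputs as 19076 (w2-c4's good-core-vertex port is kernel modulo [S24]:
p432125/p434592/p434819); off it, Kim 2025 Thm 1.2's ∂^{(∞)} = ∂^{(∞)}_deep is claimed in print for
all these rows but by the same Kato-KS mechanism with Euler factors at good/multiplicative 3 (w2-c4
domain audit). STATE (2026-08-26, w2-c4 g5 DONE; TARGET v6.37 E108 (e)): landed p449980 / p450678 /
p452078 `Theorems/KimAtThreeShallowEqDeepOffStratumManinDefect` (below N ≤ 300 000 the additiv -/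
@[route_item "route-BirchSwinnertonDyer-KimAtThreeKolyvagin"]
def ShallowEqDeepOffKatoStratum : Prop :=
  ∀ (W₀ : WeierstrassCurve ℚ) [W₀.IsElliptic] [W₀.IsGloballyMinimal], (∀ n : ℕ, W₀.HasSurjectiveModNGaloisRep (3 ^ n : ℕ)) → Nat.card {Q : (W₀.baseChange ℚ_[3]).toAffine.Point // (3 : ℕ) • Q = 0} = 1 → Finite W₀.sha → ∀ {N : ℕ} [NeZero N], N = W₀.conductorNorm ℤ → ∀ (D₀ : Literature.NumberTheory.EllipticCurves.ModularForms.ModularParametrizationData W₀ N), (∀ z ∈ D₀.L.lattice, ∃ w ∈ Literature.NumberTheory.EllipticCurves.ModularForms.periodLattice D₀.f, z = D₀.c * w) → (∀ (W₂ : WeierstrassCurve ℚ) [W₂.IsElliptic] (D₂ : Literature.NumberTheory.EllipticCurves.ModularForms.ModularParametrizationData W₂ N), D₂.f = D₀.f → D₀.modularDegree ≤ D₂.modularDegree) → (∀ r : ℚ, Literature.NumberTheory.EllipticCurves.ratPlusSymbol D₀.f r ≠ 0 → 0 ≤ padicValRat 3 (Literature.NumberTheory.EllipticCurves.ratPlusSymbol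 D₀.f r)) → Literature.NumberTheory.EllipticCurves.kuriharaVanishingOrder W₀ 3 D₀.f = 0 → ¬ ((haveI : Fact (Nat.Prime 3) := ⟨Nat.prime_three⟩; Literature.NumberTheory.EllipticCurves.Rank1Residual.Addv W₀ 3) ∧ ¬ 3 ∣ (W₀.baseChange ℚ_[3]).localTamagawaNumber ℤ_[3] ∧ ¬ (3 : ℤ) ∣ D₀.maninConstant) → Literature.NumberTheory.EllipticCurves.kuriharaPartialDeepInfty W₀ 3 D₀.f ≤ Literature.NumberTheory.EllipticCurves.kuriharaPartialInfty W₀ 3 D₀.f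

-- parent: ShallowEqDeepAtTorsionFree · child (gen 1)
/--     item stmt-BirchSwinnertonDyer-19598 · support · rank 401 · open
    parent: ShallowEqDeepAtTorsionFree · by planner
[support · ALIAS CONJUNCTION, held] the six shared parts of the §U split of DeepUpperAtThree
restated VERBATIM and joined by ∧ — SakamotoKolyvaginThree (19558) ∧ RankEqAnalyticRankLeOne (19921)
∧ PoitouTateSelmerDuality (19559) ∧ CarayolLevelEqConductor (19467) ∧ KatoKuriharaPortThreeShared
(crux 19560) ∧ StubAtEmptyLevelThree (crux 19561); exists only because a second parent cannot
re-list a child of this route by name (gate: «child decl_name … already exists in this route»); K1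
precedent PrintedAndReadingFacts (stmt-19478). Never a proving target: the work lives on
19560/19561, the four leaves are published inputs by name. -/
@[route_item "route-BirchSwinnertonDyer-KimAtThreeKolyvagin", crux]
def DeepUpperSplitSharedParts : Prop :=
  (Literature.NumberTheory.GaloisCohomology.Sakamoto2024.kolyvaginSystems_freeRankOne_zmod_three_pow ∧ Literature.NumberTheory.GaloisCohomology.Sakamoto2024.kolyvaginSystems_idealOfBasis_eq_fittingIdeal_zmod_three_pow) ∧ (Literature.NumberTheory.EllipticCurves.rank_eq_analyticRank_of_analyticRank_le_one) ∧ (Literature.NumberTheory.GaloisCohomology.poitouTate_selmerStructure_duality ℚ) ∧ (∀ (N : ℕ) [NeZero N], Literature.NumberTheory.EllipticCurves.ModularForms.IsNewformOf.level_eq_conductorNorm (N := N)) ∧ (∀ (W : WeierstrassCurve ℚ) [W.IsElliptic] [W.IsGloballyMinimal], (∀ m : ℕ, W.HasSurjectiveModNGaloisRep (3 ^ m : ℕ)) → (haveI : Fact (Nat.Prime 3) := ⟨Nat.prime_three⟩; Literature.NumberTheory.EllipticCurves.Rank1Residual.Addv W 3) → ¬ 3 ∣ (W.baseChange ℚ_[3]).localTamagawaNumber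 ℤ_[3] → Nat.card {Q : (W.baseChange ℚ_[3]).toAffine.Point // (3 : ℕ) • Q = 0} = 1 → ∀ (v₃ : IsDedekindDomain.HeightOneSpectrum (NumberField.RingOfIntegers ℚ)), ((3 : ℕ) : NumberField.RingOfIntegers ℚ) ∈ v₃.asIdeal → ∀ (η : (q : IsDedekindDomain.HeightOneSpectrum (NumberField.RingOfIntegers ℚ)) → (ZMod (Ideal.absNorm q.asIdeal))ˣ), (∀ q, Subgroup.zpowers (η q) = ⊤) → ∀ {N : ℕ} [NeZero N] (P : Literature.NumberTheory.EllipticCurves.ModularForms.ModularParametrizationData W N), N = W.conductorNorm ℤ → (∀ z ∈ P.L.lattice, ∃ w ∈ Literature.NumberTheory.EllipticCurves.ModularForms.periodLattice P.f, z = P.c * w) → ¬ (3 : ℤ) ∣ P.maninConstant → Summit.BirchSwinnertonDyer.Rank1Residual.GaloisImage.KatoKuriharaPortThreeAtWith₂ W 0 v₃ η P) ∧ (∀ (W : WeierstrassCurve ℚ) [W.IsElliptic] [W.IsGloballyMinimal], (∀ m : ℕ, W.HasSurjectiveModNGaloisRep (3 ^ m : ℕ)) → ∀ (η : (q : IsDedekindDomain.HeightOneSpectrum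 (NumberField.RingOfIntegers ℚ)) → (ZMod (Ideal.absNorm q.asIdeal))ˣ), (∀ q, Subgroup.zpowers (η q) = ⊤) → ∀ (k : ℕ) (Dk : Literature.NumberTheory.GaloisCohomology.KolyvaginDatum (W.torsionGaloisModule (((3 : ℕ) : ℤ) ^ k * ((3 : ℕ) : ℤ)))) (g : Finset (IsDedekindDomain.HeightOneSpectrum (NumberField.RingOfIntegers ℚ)) → Literature.NumberTheory.GaloisRepresentations.galoisCohomology (W.torsionGaloisModule (((3 : ℕ) : ℤ) ^ k * ((3 : ℕ) : ℤ))) 1) (n₀ : ℕ), Dk.IsCanonicalTauDatumThreeAtWith W k k η → g ∈ Dk.kolyvaginSystems (Summit.BirchSwinnertonDyer.Rank1Residual.GaloisImage.propagatedSelmerStructure W 3 k) → (∀ κ ∈ Dk.kolyvaginSystems (Summit.BirchSwinnertonDyer.Rank1Residual.GaloisImage.propagatedSelmerStructure W 3 k), ∃ a : ℕ, κ = a • g) → Nat.card (Summit.BirchSwinnertonDyer.Rank1Residual.GaloisImage.propagatedSelmerStructure W 3 k).selmerGroup = 3 ^ (k + 1) * 3 ^ n₀ → ∃ e ∈ (Summit.BirchSwinnertonDyer.Rank1Residual.GaloisImage.propagatedSelmerStructure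 W 3 k).selmerGroup, ∃ m ∈ (W.kummerSelmerStructure (((3 : ℕ) : ℤ) ^ k * ((3 : ℕ) : ℤ))).selmerGroup, g ∅ = 3 ^ n₀ • e + m)

-- parent: ShallowEqDeepAtTorsionFree · glue (gen 1)
/--     item stmt-BirchSwinnertonDyer-19600 · support · rank 403 · closed · proved by Summit.BirchSwinnertonDyer.BirchSwinnertonDyer.Theorems.KimAtThreeShallowEqDeepSplitGlue.shallowEqDeepOfParts_proof (prover)
    parent: ShallowEqDeepAtTorsionFree · GLUE: children ⟹ parent · by planner
§S glue (k = 2): DeepUpperSplitSharedParts → ShallowEqDeepOffKatoStratum →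
ShallowEqDeepAtTorsionFree. PROVED in the planner scratch EnvW2S2.lean
(`shallowEqDeepOfParts2_proof`, rc 0, 0 sorries): destructure the alias conjunction into the six §U
parts (Sakamoto ×2, GZK, Poitou–Tate, Carayol, PORT″ C1, stub C2), reduce to optimal data at
conductor level by kim3's
`KimAtThreeKolyvaginIsogenyCruxes.shallowEqDeepAtTorsionFree_of_forall_optimalDatum_atConductor`,
then by_cases on the Kato stratum: ON it
`KimAtThreeDeepUpperOfPortsClasswide.shallowEqDeep_conclusion_classwide_of_ports_of_stub` (p435413)
with W = W₀ (IsIsogenous.refl_holds), v₃ = primesEquiv.symm 3, one generator family η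
(IsCyclic.exists_generator); OFF it the crux ShallowEqDeepOffKatoStratum verbatim. A W2 hand lands
it as Theorems/KimAtThreeShallowEqDeepSplitGlue.lean --workitem <glue item>. -/
@[route_item "route-BirchSwinnertonDyer-KimAtThreeKolyvagin"]
def ShallowEqDeepOfParts : Prop :=
  DeepUpperSplitSharedParts → ShallowEqDeepOffKatoStratum → ShallowEqDeepAtTorsionFree

-- `ShallowEqDeepOfParts` holds: proved by `Summit.BirchSwinnertonDyer.BirchSwinnertonDyer.Theorems.KimAtThreeShallowEqDeepSplitGlue.shallowEqDeepOfParts_proof` (its module imports this route file, so no `_holds` link can be stated here).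

/-- item stmt-BirchSwinnertonDyer-19579 · support · rank 9 · open · by planner
[support] by-name PUBLISHED LEAF (singleton, director-bsd ruling (c) 10:01:17Z): Sakamoto 2024 Thm
1.1(1)/Thm 5.9 at p = 3 — KS(T, F_can, P) free of rank one over Z/3^k for residually abs.
irreducible T (no (H.6), no p ≥ 5); conjunct 1 of the split leaf SakamotoKolyvaginThree
(stmt-19558); exists so the cited fact is item-stated (deps exemption) and appears on the PUB
register by name; HELD, not a proving target. Source: Sakamoto2024 (arXiv:2203.08092) Thm 5.9. -/
@[route_item "route-BirchSwinnertonDyer-KimAtThreeKolyvagin"]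
def SakamotoKolyvaginFreeRankOneThree : Prop :=
  Literature.NumberTheory.GaloisCohomology.Sakamoto2024.kolyvaginSystems_freeRankOne_zmod_three_pow

/-- item stmt-BirchSwinnertonDyer-19594 · support · rank 9 · open · by planner
[support] by-name PUBLISHED LEAF (singleton, director-bsd ruling (c) 10:01:17Z): Sakamoto 2024 Thm
1.1(2)/Cor 5.12 at p = 3 — the ideal generated by a basis of KS(T, F_can, P) over Z/3^k equals Fitt⁰
of the dual Selmer group H¹_{F_can*}(Q, T^∨(1))^∨; conjunct 2 of the split leaf
SakamotoKolyvaginThree (stmt-19558); exists so the cited fact is item-stated (deps exemption) and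
appears on the PUB register by name; HELD, not a proving target. Source: Sakamoto2024
(arXiv:2203.08092) Cor 5.12. -/
@[route_item "route-BirchSwinnertonDyer-KimAtThreeKolyvagin"]
def SakamotoKolyvaginFittingIdealThree : Prop :=
  Literature.NumberTheory.GaloisCohomology.Sakamoto2024.kolyvaginSystems_idealOfBasis_eq_fittingIdeal_zmod_three_pow

/-- item stmt-BirchSwinnertonDyer-20013 · support · rank 9 · open · by planner
why it might fail: TRUE for φ = exp*_ω at ℚ₃ once DEFINED, with b = 2 (acc3 g5: b = c + v₃(m) ≤ c + 1, tame level); as TYPED one b serves every tame level r and every j — if exp*'s denominators on H¹(K_𝔓, T₃W), 𝔓 | 3 in ℚ(μ_m), were not uniformly bounded the fixed b fails; hdual presumes E(ℚ₃)[3] = 0 on the row.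
sources: Kato2004Asterisque, BlochKato1990, Kim2022StructureSelmer, MazurRubin2004KolyvaginSystems
[support · (C1ₑₓ) ⊂ (C1ᵤ): the DEFINED-exp* uniform package, smaller displayed residual (w2-c3 g7)]
per surjective-tower curve W, v₃ | 3, optimal parametrisation at the conductor: ∃ ι κK Λ and ONE
additive functional φ : H¹(ℚ_{v₃}, T₃W) → ℚ₃ with κK ≠ 0, hker(φ) (kernel = Kummer/finite condition
at every level: [BK90] Prop 3.8 / Ex 3.11), hdual(φ) (image = (log_ω E(ℚ₃))^∨: Tate local duality +
[BK90] 3.8), ONE crude compatibility X1-int_b between Λ_{0,r} and φ modulo 3^{j+1−b}L_int, and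
Kato's ZetaBody family in Λ. NOT displayed any more: Λfin, (Λ)-clauses, RIDER₂, κ ∈ ℚ (DERIVED,
p494680 §1), t/e, S24-DEEP, K_w objects. 19076/19562 BY NAME from it + the four leaves (p494680);
19075/19679/deepPUB pending w2-c3 file 5. -/
@[route_item "route-BirchSwinnertonDyer-KimAtThreeKolyvagin"]
def DefinedKatoUniformThree : Prop :=
  open Literature.NumberTheory.EllipticCurves.Kato2004.EulerSystemValues Literature.NumberTheory.GaloisRepresentations Summit.BirchSwinnertonDyer.Rank1Residual.GaloisImage in ∀ (W : WeierstrassCurve ℚ) [W.IsElliptic] [W.IsGloballyMinimal] [ContinuousSMul ℤ_[3] (W.tateModule 3)] [Module.Free ℤ_[3] (W.tateModule 3)] [Module.Finite ℤ_[3] (W.tateModule 3)], (∀ m : ℕ, W.HasSurjectiveModNGaloisRep (3 ^ m : ℕ)) → ∀ (v₃ : IsDedekindDomain.HeightOneSpectrum (NumberField.RingOfIntegers ℚ)), ((3 : ℕ) : NumberField.RingOfIntegers ℚ) ∈ v₃.asIdeal → ∀ {N : ℕ} [NeZero N] (P : NumberTheory.EllipticCurves.ModularForms.ModularParametrizationData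 W N), N = W.conductorNorm ℤ → (∀ z ∈ P.L.lattice, ∃ w ∈ NumberTheory.EllipticCurves.ModularForms.periodLattice P.f, z = P.c * w) → ∃ (ι : (n : ℕ) → (CyclotomicField n ℚ →+* ℂ)) (κK : ℝ) (Λ : ∀ (k' : ℕ) (r : Finset (IsDedekindDomain.HeightOneSpectrum (NumberField.RingOfIntegers ℚ))), H1 (tateRep W 3) (cycSubgroup 3 k' r) →ₗ[ℤ_[3]] TensorProduct ℚ ℚ_[3] (CyclotomicField (cycLevel 3 k' r) ℚ)) (φ : (tateLocalRep W 3 (Sum.inr v₃)).cohomology 1 →+ ℚ_[3]), κK ≠ 0 ∧ (∀ y, φ y = 0 ↔ ∀ j : ℕ, tateLocalMap W 3 j (Sum.inr v₃) y ∈ W.kummerSelmerStructure (((3 : ℕ) : ℤ) ^ j * ((3 : ℕ) : ℤ)) (Sum.inr v₃)) ∧ (∀ a : ℚ_[3], (∃ y, φ y = a) ↔ ∀ Q : (W.baseChange ℚ_[3]).toAffine.Point, ‖a * Rank1Residual.Additive.LocalLog.padicLog (W.baseChange ℚ_[3]) Q‖ ≤ 1) ∧ (∃ b : ℕ, ∀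 (j : ℕ) (r : Finset (IsDedekindDomain.HeightOneSpectrum (NumberField.RingOfIntegers ℚ))) (Ψ : H1 (tateRep W 3) (cycSubgroup 3 0 r) →+ continuousCohomology 1 (subgroupRep (W.torsionGaloisModule (((3 : ℕ) : ℤ) ^ j * ((3 : ℕ) : ℤ))).toTopRep (cycSubgroup 3 0 r))), (∀ (φ₁ : contOneCocycles (subgroupRep (tateRep W 3).toTopRep (cycSubgroup 3 0 r))) (ψ : contOneCocycles (subgroupRep (W.torsionGaloisModule (((3 : ℕ) : ℤ) ^ j * ((3 : ℕ) : ℤ))).toTopRep (cycSubgroup 3 0 r))), (∀ g, ((ψ.1 g : W.geomTorsion (((3 : ℕ) : ℤ) ^ j * ((3 : ℕ) : ℤ))) : W.geomPoints) = Literature.NumberTheory.EllipticCurves.TateModule.proj 3 (j + 1) (φ₁.1 g)) → Ψ (oneCocycleClass _ φ₁) = oneCocycleClass _ ψ) → ∀ (y : H1 (tateRep W 3) (cycSubgroup 3 0 r)) (κ₀ : galoisCohomology (W.torsionGaloisModule (((3 : ℕ) : ℤ) ^ j * ((3 : ℕ) : ℤ))) 1) (h : (tateLocalRep W 3 (Sum.inr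 v₃)).cohomology 1), resSubgroup (W.torsionGaloisModule (((3 : ℕ) : ℤ) ^ j * ((3 : ℕ) : ℤ))).toTopRep (cycSubgroup 3 0 r) 1 κ₀ = Ψ y → galoisCohomology.localization (W.torsionGaloisModule (((3 : ℕ) : ℤ) ^ j * ((3 : ℕ) : ℤ))) (Sum.inr v₃) 1 κ₀ = tateLocalMap W 3 j (Sum.inr v₃) h → ∃ l ∈ cycIntLattice 3 (cycLevel 3 0 r), (((3 : ℕ) : ℤ_[3]) ^ b) • (TensorProduct.tmul ℚ (φ h) (1 : CyclotomicField (cycLevel 3 0 r) ℚ) - Λ 0 r y) = (((3 : ℕ) : ℤ_[3]) ^ (j + 1)) • (l : TensorProduct ℚ ℚ_[3] (CyclotomicField (cycLevel 3 0 r) ℚ))) ∧ ∀ (c d a : ℤ) (A : ℕ), 0 < A → Int.gcd c (6 * 3 * A) = 1 → Int.gcd d (6 * 3 * N) = 1 → ∃ (z : ∀ (k' : ℕ) (r : (cyclotomicLevelsRat 3 (badPlaces c d A N)).Ideals), H1 (tateRep W 3) ((cyclotomicLevelsRat 3 (badPlaces c d A N)).level k' r.1)) (x : ∀ (k' : ℕ)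 (r : (cyclotomicLevelsRat 3 (badPlaces c d A N)).Ideals), CyclotomicField (cycLevel 3 k' r.1) ℚ), Literature.NumberTheory.EllipticCurves.Kato2004.ZetaBody W 3 P.f ι κK Λ c d a A z x

/-- item stmt-BirchSwinnertonDyer-20275 · support · rank 9 · open · by planner
[support · (C1ₑₓʷ)] WEIGHTED defined-Kato package on the non-additive non-anomalous t = 0 rows of
19599 / 19077 (w2-c4 g11): 20396 DefinedKatoUnitNonAdditiveThree with the crude compatibility
COMPAT₁ replaced by «∃ θ : ∀ r, ℚ(ζ_m), 1⊗θ_r ∈ L_int ∧ ∃ l₀ ∈ L_int, (1⊗θ_r)² l₀ = 3⊗1 ∧ ∀ j,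
COMPATW_1⟦θ⟧» (θ_r = 1 at tame levels, 1 − ζ₃-type weight at wild levels 3 ∣ m, where b = 1 is false
for Kato’s defined exp* on ordinary rows). Supersedes 20396 (20396 ⟹ this item:
definedKatoWeighted_of_definedKatoUnit, p526409); rows + (C1′₂) + port BY NAME:
Theorems/KimAtThreeShallowEqDeepOffStratumOfDefinedKatoWeighted.lean (p526409), parity rider
p525508; DISCHARGE ROAD IN THE KERNEL: (C1ₑₓʷ) ⟸ (S5a) ∧ (S5b-tower) ∧ hKatoV2ʷ (p531776
definedKatoWeighted_of_katoV2_of_facts) — the deep family’s Kato-side statement plus Kato’s R-κ.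
Text = w2c4/ITEM-TEXT-DefinedKatoWeightedNonAdditiveThree-g11.txt sha16 cd731642448d847a; scratch
ItemTextCheck.lean rc 0 (w2-c4 12:59Z, planner 13:00Z). Pre-authorised: director-bsd g9 INBOX l.274
(1). Nothing here proves BSD. -/
@[route_item "route-BirchSwinnertonDyer-KimAtThreeKolyvagin"]
def DefinedKatoWeightedNonAdditiveThree : Prop :=
  open Literature.NumberTheory.EllipticCurves.Kato2004.EulerSystemValues Literature.NumberTheory.GaloisRepresentations.galoisCohomology Literature.NumberTheory.GaloisRepresentations Summit.BirchSwinnertonDyer.Rank1Residual.GaloisImage Literature.NumberTheory.EllipticCurves.ModularForms Literature.NumberTheory.EllipticCurves.Kato2004 Literature.NumberTheory.EllipticCurves.TateModule Literature.NumberTheory.EllipticCurves.Rank1Residual Summit.BirchSwinnertonDyer.Rank1Residual.Additive.LocalLog WeierstrassCurve IsDedekindDomain NumberField in (∀ (W₀ : WeierstrassCurve ℚ) [W₀.IsElliptic] [W₀.IsGloballyMinimal], (∀ n : ℕ, W₀.HasSurjectiveModNGaloisRep (3 ^ n : ℕ)) → Nat.card {Q : (W₀.baseChange ℚ_[3]).toAffine.Point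 // (3 : ℕ) • Q = 0} = 1 → ∀ {N : ℕ} [NeZero N], N = W₀.conductorNorm ℤ → ∀ (D₀ : ModularParametrizationData W₀ N), (∀ z ∈ D₀.L.lattice, ∃ w ∈ periodLattice D₀.f, z = D₀.c * w) → (∀ (W₂ : WeierstrassCurve ℚ) [W₂.IsElliptic] (D₂ : ModularParametrizationData W₂ N), D₂.f = D₀.f → D₀.modularDegree ≤ D₂.modularDegree) → ¬ (haveI : Fact (Nat.Prime 3) := ⟨Nat.prime_three⟩; Addv W₀ 3) → ∀ (v₃ : HeightOneSpectrum (RingOfIntegers ℚ)), ((3 : ℕ) : RingOfIntegers ℚ) ∈ v₃.asIdeal → ∀ [ContinuousSMul ℤ_[3] (tateModule W₀ 3)] [Module.Free ℤ_[3] (tateModule W₀ 3)] [Module.Finite ℤ_[3] (tateModule W₀ 3)], (∃ (ι : (n : ℕ) → (CyclotomicField n ℚ →+* ℂ)) (κK : ℝ) (Λ : ∀ (k' : ℕ) (r : Finset (HeightOneSpectrum (RingOfIntegers ℚ))), H1 (tateRep W₀ 3) (cycSubgroup 3 k' r) →ₗ[ℤ_[3]] TensorProduct ℚ ℚ_[3]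 (CyclotomicField (cycLevel 3 k' r) ℚ)) (φ : (tateLocalRep W₀ 3 (Sum.inr v₃)).cohomology 1 →+ ℚ_[3]) (θ : ∀ r : Finset (HeightOneSpectrum (RingOfIntegers ℚ)), CyclotomicField (cycLevel 3 0 r) ℚ), κK ≠ 0 ∧ (∃ u : ℚ, (u : ℝ) = κK ∧ padicValRat 3 u = 0) ∧ (∀ y, φ y = 0 ↔ ∀ j : ℕ, tateLocalMap W₀ 3 j (Sum.inr v₃) y ∈ kummerSelmerStructure W₀ (((3 : ℕ) : ℤ) ^ j * ((3 : ℕ) : ℤ)) (Sum.inr v₃)) ∧ (∀ a : ℚ_[3], (∃ y, φ y = a) ↔ ∀ Q : (W₀.baseChange ℚ_[3]).toAffine.Point, ‖a * padicLog (W₀.baseChange ℚ_[3]) Q‖ ≤ 1) ∧ (∀ r : Finset (HeightOneSpectrum (RingOfIntegers ℚ)), (1 : ℚ_[3]) ⊗ₜ[ℚ] θ r ∈ cycIntLattice 3 (cycLevel 3 0 r) ∧ ∃ l₀ ∈ cycIntLattice 3 (cycLevel 3 0 r), (1 : ℚ_[3]) ⊗ₜ[ℚ] θ r * (1 : ℚ_[3])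 ⊗ₜ[ℚ] θ r * l₀ = ((3 : ℕ) : ℚ_[3]) ⊗ₜ[ℚ] (1 : CyclotomicField (cycLevel 3 0 r) ℚ)) ∧ (∀ j : ℕ, (∀ (r : Finset (HeightOneSpectrum (RingOfIntegers ℚ))) (Ψ : H1 (tateRep W₀ 3) (cycSubgroup 3 0 r) →+ continuousCohomology 1 (subgroupRep (torsionGaloisModule W₀ (((3 : ℕ) : ℤ) ^ j * ((3 : ℕ) : ℤ))).toTopRep (cycSubgroup 3 0 r))), (∀ (φ₁ : contOneCocycles (subgroupRep (tateRep W₀ 3).toTopRep (cycSubgroup 3 0 r))) (ψ : contOneCocycles (subgroupRep (torsionGaloisModule W₀ (((3 : ℕ) : ℤ) ^ j * ((3 : ℕ) : ℤ))).toTopRep (cycSubgroup 3 0 r))), (∀ g, ((ψ.1 g : geomTorsion W₀ (((3 : ℕ) : ℤ) ^ j * ((3 : ℕ) : ℤ))) : geomPoints W₀) = proj 3 (j + 1) (φ₁.1 g)) → Ψ (oneCocycleClass _ φ₁) = oneCocycleClass _ ψ) → ∀ (y : H1 (tateRep W₀ 3) (cycSubgroup 3 0 r)) (κ₀ : galoisCohomology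 (torsionGaloisModule W₀ (((3 : ℕ) : ℤ) ^ j * ((3 : ℕ) : ℤ))) 1) (h : (tateLocalRep W₀ 3 (Sum.inr v₃)).cohomology 1), resSubgroup (torsionGaloisModule W₀ (((3 : ℕ) : ℤ) ^ j * ((3 : ℕ) : ℤ))).toTopRep (cycSubgroup 3 0 r) 1 κ₀ = Ψ y → localization (torsionGaloisModule W₀ (((3 : ℕ) : ℤ) ^ j * ((3 : ℕ) : ℤ))) (Sum.inr v₃) 1 κ₀ = tateLocalMap W₀ 3 j (Sum.inr v₃) h → ∃ l ∈ cycIntLattice 3 (cycLevel 3 0 r), (1 : ℚ_[3]) ⊗ₜ[ℚ] θ r * ((((3 : ℕ) : ℤ_[3]) ^ 1) • (φ h ⊗ₜ[ℚ] (1 : CyclotomicField (cycLevel 3 0 r) ℚ) - Λ 0 r y)) = (((3 : ℕ) : ℤ_[3]) ^ (j + 1)) • l)) ∧ ∀ (c d a : ℤ) (A : ℕ), 0 < A → Int.gcd c (6 * 3 * A) = 1 → Int.gcd d (6 * 3 * N) = 1 → ∃ (z : ∀ (k' : ℕ) (r : (cyclotomicLevelsRat 3 (badPlaces c d A N)).Ideals),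 H1 (tateRep W₀ 3) ((cyclotomicLevelsRat 3 (badPlaces c d A N)).level k' r.1)) (x : ∀ (k' : ℕ) (r : (cyclotomicLevelsRat 3 (badPlaces c d A N)).Ideals), CyclotomicField (cycLevel 3 k' r.1) ℚ), ZetaBody W₀ 3 D₀.f ι κK Λ c d a A z x))

/-- item stmt-BirchSwinnertonDyer-20396 · support · rank 9 · open · by planner
why it might fail: As TYPED one b = 1 serves every tame level r and every j: fails if exp*_ω on H¹(K_𝔓, T₃W), 𝔓 | 3 in ℚ(μ_m), had denominators worse than 3⁻¹ at some level; R-κ presumes Kato's constant is a 3-unit on the row (3 ∤ c_P, Manin constant prime to 3).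
sources: Kato2004Asterisque, BlochKato1990, Kim2022StructureSelmer, Mazur1977
[support · (C1ₑₓ¹ᵘ)[non-additive t = 0 rows] = `DefinedKatoUniformThree` (item 20013, (C1ₑₓ)) read
with the EXACT crude exponent b := 1 and R-κ (κK ∈ ℚ a 3-adic unit), restricted to the
surjective-tower rows with E(ℚ₃)[3] = 0 and NON-additive reduction at 3 (w2-c4 g10 memo
W2C4-MULT-TWOEXP-g10.md db52aec2 §5; text
HOME/w2c4/ITEM-TEXT-DefinedKatoUnitNonAdditiveThree-g10.txt 3c819544, re-spelled ≤ 4 000 chars with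
a term-level `open … in` (SHORT form), Iff.rfl-equal to `DefinedKatoUnitNonAdditiveThreeDraft` of
HOME/w2c4/lean-g10/FineKatoOffSigRoute.lean, planner check rc 0)] per such curve W₀, v₃ | 3, optimal
parametrisation D₀ at the conductor: ∃ ι, κK (rational 3-unit), Λ and ONE additive functional φ :
H¹(ℚ_{v₃}, T₃W₀) → ℚ₃ with hker / hdual ([BK90] Prop 3.8 / Ex 3.11, Tate duality), the compatibility
«3·(φ(h) ⊗ 1 − Λ_{0,r}(y)) ∈ 3^{j+1}·L_int» (b = 1) and Kato's ZetaBody family in Λ. (C1ₑₓ¹ᵘ) ⟹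
(C1ₑₓ) on its rows; with the four leaves it gives the non-additive NON-anomalous t = 0 rows of 19599
`ShallowEqDeepOffKatoStratum` and of 19077 via the landed glue p510665
`KimAtThreeShallowEqDeepOffStratumOfDefinedKato.shallowEqDeepOffKatoStratum_of_leaves_of_definedKatoUnit`
(binder hEX) -/
@[route_item "route-BirchSwinnertonDyer-KimAtThreeKolyvagin", crux]
def DefinedKatoUnitNonAdditiveThree : Prop :=
  open Literature.NumberTheory.EllipticCurves.Kato2004.EulerSystemValues Literature.NumberTheory.GaloisRepresentations.galoisCohomology Literature.NumberTheory.GaloisRepresentations Summit.BirchSwinnertonDyer.Rank1Residual.GaloisImage Literature.NumberTheory.EllipticCurves.ModularForms Literature.NumberTheory.EllipticCurves.Kato2004 Literature.NumberTheory.EllipticCurves.TateModule Literature.NumberTheory.EllipticCurves.Rank1Residual Summit.BirchSwinnertonDyer.Rank1Residual.Additive.LocalLog WeierstrassCurve IsDedekindDomain NumberField in (∀ (W₀ : WeierstrassCurve ℚ) [W₀.IsElliptic] [W₀.IsGloballyMinimal], (∀ n : ℕ, W₀.HasSurjectiveModNGaloisRep (3 ^ n : ℕ)) → Nat.card {Q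 : (W₀.baseChange ℚ_[3]).toAffine.Point // (3 : ℕ) • Q = 0} = 1 → ∀ {N : ℕ} [NeZero N], N = W₀.conductorNorm ℤ → ∀ (D₀ : ModularParametrizationData W₀ N), (∀ z ∈ D₀.L.lattice, ∃ w ∈ periodLattice D₀.f, z = D₀.c * w) → (∀ (W₂ : WeierstrassCurve ℚ) [W₂.IsElliptic] (D₂ : ModularParametrizationData W₂ N), D₂.f = D₀.f → D₀.modularDegree ≤ D₂.modularDegree) → ¬ (haveI : Fact (Nat.Prime 3) := ⟨Nat.prime_three⟩; Addv W₀ 3) → ∀ (v₃ : HeightOneSpectrum (RingOfIntegers ℚ)), ((3 : ℕ) : RingOfIntegers ℚ) ∈ v₃.asIdeal → ∀ [ContinuousSMul ℤ_[3] (tateModule W₀ 3)] [Module.Free ℤ_[3] (tateModule W₀ 3)] [Module.Finite ℤ_[3] (tateModule W₀ 3)], (∃ (ι : (n : ℕ) → (CyclotomicField n ℚ →+* ℂ)) (κK : ℝ) (Λ : ∀ (k' : ℕ) (r : Finset (HeightOneSpectrum (RingOfIntegers ℚ))), H1 (tateRep W₀ 3) (cycSubgroup 3 k' r) →ₗ[ℤ_[3]]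 TensorProduct ℚ ℚ_[3] (CyclotomicField (cycLevel 3 k' r) ℚ)) (φ : (tateLocalRep W₀ 3 (Sum.inr v₃)).cohomology 1 →+ ℚ_[3]), κK ≠ 0 ∧ (∃ u : ℚ, (u : ℝ) = κK ∧ padicValRat 3 u = 0) ∧ (∀ y, φ y = 0 ↔ ∀ j : ℕ, tateLocalMap W₀ 3 j (Sum.inr v₃) y ∈ kummerSelmerStructure W₀ (((3 : ℕ) : ℤ) ^ j * ((3 : ℕ) : ℤ)) (Sum.inr v₃)) ∧ (∀ a : ℚ_[3], (∃ y, φ y = a) ↔ ∀ Q : ((W₀ : WeierstrassCurve ℚ).baseChange ℚ_[3]).toAffine.Point, ‖a * padicLog ((W₀ : WeierstrassCurve ℚ).baseChange ℚ_[3]) Q‖ ≤ 1) ∧ (∀ j : ℕ, (∀ (r : Finset (HeightOneSpectrum (RingOfIntegers ℚ))) (Ψ : H1 (tateRep W₀ 3) (cycSubgroup 3 0 r) →+ continuousCohomology 1 (subgroupRep (torsionGaloisModule W₀ (((3 : ℕ) : ℤ) ^ j * ((3 : ℕ) : ℤ))).toTopRep (cycSubgroup 3 0 r))), (∀ (φ₁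 : contOneCocycles (subgroupRep (tateRep W₀ 3).toTopRep (cycSubgroup 3 0 r))) (ψ : contOneCocycles (subgroupRep (torsionGaloisModule W₀ (((3 : ℕ) : ℤ) ^ j * ((3 : ℕ) : ℤ))).toTopRep (cycSubgroup 3 0 r))), (∀ g, ((ψ.1 g : geomTorsion W₀ (((3 : ℕ) : ℤ) ^ j * ((3 : ℕ) : ℤ))) : geomPoints W₀) = proj 3 (j + 1) (φ₁.1 g)) → Ψ (oneCocycleClass _ φ₁) = oneCocycleClass _ ψ) → ∀ (y : H1 (tateRep W₀ 3) (cycSubgroup 3 0 r)) (κ₀ : galoisCohomology (torsionGaloisModule W₀ (((3 : ℕ) : ℤ) ^ j * ((3 : ℕ) : ℤ))) 1) (h : (tateLocalRep W₀ 3 (Sum.inr v₃)).cohomology 1), resSubgroup (torsionGaloisModule W₀ (((3 : ℕ) : ℤ) ^ j * ((3 : ℕ) : ℤ))).toTopRep (cycSubgroup 3 0 r) 1 κ₀ = Ψ y → localization (torsionGaloisModule W₀ (((3 : ℕ) : ℤ) ^ j * ((3 : ℕ) : ℤ))) (Sum.inr v₃) 1 κ₀ = tateLocalMap W₀ 3 j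 (Sum.inr v₃) h → ∃ l ∈ cycIntLattice 3 (cycLevel 3 0 r), (((3 : ℕ) : ℤ_[3]) ^ (1 : ℕ)) • ((TensorProduct.tmul ℚ (φ h) (1 : CyclotomicField (cycLevel 3 0 r) ℚ)) - Λ 0 r y) = (((3 : ℕ) : ℤ_[3]) ^ (j + 1)) • (l : TensorProduct ℚ ℚ_[3] (CyclotomicField (cycLevel 3 0 r) ℚ)))) ∧ ∀ (c d a : ℤ) (A : ℕ), 0 < A → Int.gcd c (6 * 3 * A) = 1 → Int.gcd d (6 * 3 * N) = 1 → ∃ (z : ∀ (k' : ℕ) (r : (cyclotomicLevelsRat 3 (badPlaces c d A N)).Ideals), H1 (tateRep W₀ 3) ((cyclotomicLevelsRat 3 (badPlaces c d A N)).level k' r.1)) (x : ∀ (k' : ℕ) (r : (cyclotomicLevelsRat 3 (badPlaces c d A N)).Ideals), CyclotomicField (cycLevel 3 k' r.1) ℚ), ZetaBody W₀ 3 (D₀ : ModularParametrizationData W₀ N).f ι κK Λ c d a A z x))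

/-- item stmt-BirchSwinnertonDyer-20397 · support · rank 9 · open · by planner
why it might fail: The Euler-factor form of the compatibility needs P_w to act injectively on ℚ₃ ⊗ ℚ(ζ_m) at every tame level used (X² − a₃X + 3 coprime to X^d − 1); at a level where a root of unity of order d is a Frobenius eigenvalue mod 3 the clause as typed can fail.
sources: Kato2004Asterisque, BlochKato1990, Kim2022StructureSelmer, MazurRubin2004
[support · (C1_τ)[good ANOMALOUS t = 0 rows] — the finer per-factor package on the good-reduction
rows with a₃ ≡ 1 (mod 3), where the 3-scaled value side loses the digit (3·E₃(1) = #Ẽ(𝔽₃) ≡ 0) and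
(C1ₑₓ¹ᵘ) is true but useless (w2-c4 g9 §2 Euler-factor lattice + g10 memo db52aec2 §5; text
HOME/w2c4/ITEM-TEXT-FineKatoTauAnomalousThree-g10.txt 4748ba91 (SHORT form ≤ 4 000 chars, term-level
`open … in`), Iff.rfl-equal to `FineKatoTauAnomalousThreeDraft`, planner check rc 0)] per
surjective-tower curve W₀ with good anomalous reduction at 3 and E(ℚ₃)[3] = 0, optimal D₀ at the
conductor: ∃ ι κK Λ φ as in (C1ₑₓ) plus the Euler-factor compatibility «3·(φ(h) ⊗ 1 − Λ(y)) ∈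
3^{j+1}·P_w·L_int» at the levels w (P_w = the Euler factor at w acting on ℚ₃ ⊗ ℚ(ζ_m)) and ZetaBody.
It is binder hC1τ of the landed glue p510665 (dispatch
`stub19599_nonAdditive_of_definedKatoUnit_of_fineKatoτ` on 3 ∤ 3 + 𝟙 − a₃); with the leaves and
(C1ₑₓ¹ᵘ) it gives every non-additive t = 0 row of 19599 / 19077. Construction lane (w2-c4
successor): needs P_w-injectivity on ℚ₃ ⊗ ℚ(ζ_m) (X² − a₃X + 3 coprime to X^d − 1). Closes nothing
by itself. -/
@[route_item "route-BirchSwinnertonDyer-KimAtThreeKolyvagin", crux]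
def FineKatoTauAnomalousThree : Prop :=
  open Literature.NumberTheory.EllipticCurves.Kato2004.EulerSystemValues Literature.NumberTheory.GaloisRepresentations.galoisCohomology Literature.NumberTheory.GaloisRepresentations Summit.BirchSwinnertonDyer.Rank1Residual.GaloisImage Literature.NumberTheory.EllipticCurves.ModularForms Literature.NumberTheory.EllipticCurves.Kato2004 Literature.NumberTheory.EllipticCurves.TateModule WeierstrassCurve IsDedekindDomain NumberField in (∀ (W₀:WeierstrassCurve ℚ) [W₀.IsElliptic] [W₀.IsGloballyMinimal], (∀ n:ℕ, W₀.HasSurjectiveModNGaloisRep (3 ^ n:ℕ)) → Nat.card {Q:(W₀.baseChange ℚ_[3]).toAffine.Point // (3:ℕ) • Q = 0} = 1 → ∀ {N:ℕ} [NeZero N], N = W₀.conductorNorm ℤ → ∀ (D₀:ModularParametrizationData W₀ N), (∀ z ∈ D₀.L.lattice, ∃ w ∈ periodLattice D₀.f, z = D₀.c * w) → (∀ (W₂:WeierstrassCurve ℚ) [W₂.IsElliptic] (D₂:ModularParametrizationData W₂ N), D₂.f = D₀.f → D₀.modularDegree ≤ D₂.modularDegree) → ¬ 3 ∣ N → ∀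 (v₃:HeightOneSpectrum (RingOfIntegers ℚ)), ((3:ℕ):RingOfIntegers ℚ) ∈ v₃.asIdeal → ∀ (t₃:ℤ), cuspCoeff D₀.f 3 = t₃ → (3:ℤ) ∣ 3 + 1 - t₃ → (∀ [ContinuousSMul ℤ_[3] (tateModule W₀ 3)] [Module.Free ℤ_[3] (tateModule W₀ 3)] [Module.Finite ℤ_[3] (tateModule W₀ 3)], ∃ (ι:(n:ℕ) → (CyclotomicField n ℚ →+* ℂ)) (κK:ℝ) (Λ:∀ (k':ℕ) (r:Finset (HeightOneSpectrum (RingOfIntegers ℚ))), H1 (tateRep W₀ 3) (cycSubgroup 3 k' r) →ₗ[ℤ_[3]] TensorProduct ℚ ℚ_[3] (CyclotomicField (cycLevel 3 k' r) ℚ)) (Λfin:∀ j:ℕ, galoisCohomology ((torsionGaloisModule W₀ (((3:ℕ):ℤ) ^ j * ((3:ℕ):ℤ))).toLocal (Sum.inr v₃)) 1 →+ ZMod (3 ^ (j + 1))), κK ≠ 0 ∧ (∃ u:ℚ, (u:ℝ) = κK ∧ padicValRat 3 u = 0) ∧ ((∀ j:ℕ, (∀ c:ZMod (3 ^ (j +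 1)), ∃ x ∈ propagatedSelmerStructure W₀ 3 j (Sum.inr v₃), Λfin j x = c) ∧ (∀ x ∈ propagatedSelmerStructure W₀ 3 j (Sum.inr v₃), Λfin j x = 0 ↔ x ∈ kummerSelmerStructure W₀ (((3:ℕ):ℤ) ^ j * ((3:ℕ):ℤ)) (Sum.inr v₃)))) ∧ (∀ j:ℕ, (∀ (r:Finset (HeightOneSpectrum (RingOfIntegers ℚ))) (w:(ZMod (cycLevel 3 0 r))ˣ), (w:ZMod (cycLevel 3 0 r)) * ((3:ℕ):ZMod (cycLevel 3 0 r)) = 1 → ∀ (Ψ:H1 (tateRep W₀ 3) (cycSubgroup 3 0 r) →+ continuousCohomology 1 (subgroupRep (torsionGaloisModule W₀ (((3:ℕ):ℤ) ^ j * ((3:ℕ):ℤ))).toTopRep (cycSubgroup 3 0 r))), (∀ (φ:contOneCocycles (subgroupRep (tateRep W₀ 3).toTopRep (cycSubgroup 3 0 r))) (ψ:contOneCocycles (subgroupRep (torsionGaloisModule W₀ (((3:ℕ):ℤ) ^ j * ((3:ℕ):ℤ))).toTopRep (cycSubgroup 3 0 r))), (∀ g, ((ψ.1 g:geomTorsion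 W₀ (((3:ℕ):ℤ) ^ j * ((3:ℕ):ℤ))):geomPoints W₀) = proj 3 (j + 1) (φ.1 g)) → Ψ (oneCocycleClass _ φ) = oneCocycleClass _ ψ) → ∀ (y:H1 (tateRep W₀ 3) (cycSubgroup 3 0 r)) (κ₀:galoisCohomology (torsionGaloisModule W₀ (((3:ℕ):ℤ) ^ j * ((3:ℕ):ℤ))) 1) (s:ℤ_[3]), resSubgroup (torsionGaloisModule W₀ (((3:ℕ):ℤ) ^ j * ((3:ℕ):ℤ))).toTopRep (cycSubgroup 3 0 r) 1 κ₀ = Ψ y → localization (torsionGaloisModule W₀ (((3:ℕ):ℤ) ^ j * ((3:ℕ):ℤ))) (Sum.inr v₃) 1 κ₀ ∈ propagatedSelmerStructure W₀ 3 j (Sum.inr v₃) → (∃ l ∈ cycIntLattice 3 (cycLevel 3 0 r), ((3:ℕ):ℤ_[3]) • Λ 0 r y - (TensorProduct.tmul ℚ ((s * (((3:ℕ):ℤ_[3]) - (t₃:ℤ_[3]) + 1):ℤ_[3]):ℚ_[3]) (1:CyclotomicField (cycLevel 3 0 r) ℚ)) = ((3:ℤ_[3]) ^ (j + 1)) • ∑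 g:(ZMod (cycLevel 3 0 r))ˣ, ((((((3:ℕ):MonoidAlgebra ℤ_[3] (ZMod (cycLevel 3 0 r))ˣ)) - MonoidAlgebra.single w (t₃:ℤ_[3]) + MonoidAlgebra.single (w ^ 2) (1:ℤ_[3])).coeff g:ℤ_[3]):ℚ_[3]) • Algebra.TensorProduct.map (AlgHom.id ℚ ℚ_[3]) (sigma (cycLevel 3 0 r) g:CyclotomicField (cycLevel 3 0 r) ℚ →ₐ[ℚ] CyclotomicField (cycLevel 3 0 r) ℚ) l) → (Λfin j) (localization (torsionGaloisModule W₀ (((3:ℕ):ℤ) ^ j * ((3:ℕ):ℤ))) (Sum.inr v₃) 1 κ₀) = PadicInt.toZModPow (j + 1) s)) ∧ (∀ (c d a:ℤ) (A:ℕ), 0 < A → Int.gcd c (6 * 3 * A) = 1 → Int.gcd d (6 * 3 * N) = 1 → ∃ (z:∀ (k':ℕ) (r:(cyclotomicLevelsRat 3 (badPlaces c d A N)).Ideals), H1 (tateRep W₀ 3) ((cyclotomicLevelsRat 3 (badPlaces c d A N)).level k' r.1)) (x:∀ (k':ℕ) (r:(cyclotomicLevelsRat 3 (badPlaces c d A N)).Ideals),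 CyclotomicField (cycLevel 3 k' r.1) ℚ), ZetaBody W₀ 3 ((D₀:ModularParametrizationData W₀ N).f) ι κK Λ c d a A z x)))

/-- item stmt-BirchSwinnertonDyer-20398 · support · rank 9 · open · by planner
why it might fail: On additive rows λ₀ = v₃(c₃) + v₃#Ẽ_ns − 1 and the typed exponent e must match Kato's actual exp*-lattice at wild levels r ∋ v₃ (acc4 FINDING-R3: ramified factors); a row with 9 | c₃·#Ẽ_ns beyond the typed shift, or a non-minimal twist model, breaks the fixed exponents.
sources: Kato2004Asterisque, BlochKato1990, Kim2022StructureSelmer, Sakamoto2024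
[support · (C1₂)[additive-defect rows] — acc3's two-exponent fine-Kato package FINEKATO₂ on the
surjective-tower rows with ADDITIVE reduction at 3 off the Kato stratum (the 3 | c₃ /
anomalous-component defect rows of 19599), 3^{v₃(c₃)}-shifted lattice (acc6), unscaled value rows
(the 3-scaled ones fail there: 3·E₃(1) = 3) (w2-c4 g10 memo db52aec2 §4–§6; text
HOME/w2c4/ITEM-TEXT-FineKatoTwoExpDefectThree-g10.txt 48cce737 (SHORT form ≤ 4 000 chars, term-level
`open … in`), Iff.rfl-equal to `FineKatoTwoExpDefectThreeDraft`, planner check rc 0)] per such curve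
W with its Tate-module instances, optimal parametrisation P at the conductor: ∃ ι κK Λ and the
two-exponent functional data (hker, hdual, RIDER₂⟦j, a, e, Λ⟧-type compatibility with e = v₃(c₃) +
v₃#Ẽ_ns(𝔽₃) − 1 ≥ 0) and ZetaBody. It is binder hC1₂ of the landed glue p510665 (additive branch via
acc3's `KimAtThreeOffStratumAdditiveDefectOfFineKato.stub19599_additiveDefect_of_fineKato`, stub₂ BY
NAME). With the two items above and the four leaves: 19599 BY NAME; with 19560 + Carayol also 19077
BY NAME (`shallowEqDeepAtTorsionFree_of_leaves_of_definedKatoUnit`). Closes nothing by itself; BSD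
is not proved by any of this. -/
@[route_item "route-BirchSwinnertonDyer-KimAtThreeKolyvagin", crux]
def FineKatoTwoExpDefectThree : Prop :=
  open Literature.NumberTheory.EllipticCurves.Kato2004.EulerSystemValues Literature.NumberTheory.GaloisRepresentations.galoisCohomology Literature.NumberTheory.GaloisRepresentations Summit.BirchSwinnertonDyer.Rank1Residual.GaloisImage Literature.NumberTheory.EllipticCurves.ModularForms Literature.NumberTheory.EllipticCurves.Kato2004 Literature.NumberTheory.EllipticCurves.TateModule Literature.NumberTheory.EllipticCurves.Rank1Residual WeierstrassCurve IsDedekindDomain NumberField in (∀ (W : WeierstrassCurve ℚ) [W.IsElliptic] [W.IsGloballyMinimal] [ContinuousSMul ℤ_[3] (W.tateModule 3)] [Module.Free ℤ_[3] (W.tateModule 3)] [Module.Finite ℤ_[3] (W.tateModule 3)], (∀ m : ℕ, W.HasSurjectiveModNGaloisRep (3 ^ m : ℕ)) → (haveI : Fact (Nat.Prime 3) := ⟨Nat.prime_three⟩; Addv W 3) → Nat.card {Q : (W.baseChange ℚ_[3]).toAffine.Point // (3 : ℕ) • Q = 0} = 1 → ∀ (v₃ : HeightOneSpectrum (RingOfIntegers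 ℚ)), ((3 : ℕ) : RingOfIntegers ℚ) ∈ v₃.asIdeal → ∀ {N : ℕ} [NeZero N] (P : ModularParametrizationData W N), N = W.conductorNorm ℤ → (∀ z ∈ P.L.lattice, ∃ w ∈ periodLattice P.f, z = P.c * w) → (3 ∣ (W.baseChange ℚ_[3]).localTamagawaNumber ℤ_[3] ∨ (3 : ℤ) ∣ P.maninConstant) → ∃ (ι : (n : ℕ) → (CyclotomicField n ℚ →+* ℂ)) (κK : ℝ) (Λ : ∀ (k' : ℕ) (r : Finset (HeightOneSpectrum (RingOfIntegers ℚ))), H1 (tateRep W 3) (cycSubgroup 3 k' r) →ₗ[ℤ_[3]] TensorProduct ℚ ℚ_[3] (CyclotomicField (cycLevel 3 k' r) ℚ)) (Λfin : ∀ j : ℕ, galoisCohomology ((W.torsionGaloisModule (((3 : ℕ) : ℤ) ^ j * ((3 : ℕ) : ℤ))).toLocal (Sum.inr v₃)) 1 →+ ZMod (3 ^ (j + 1))) (e : ℕ), κK ≠ 0 ∧ (∃ u : ℚ, (u : ℝ) = κK ∧ padicValRat 3 u = 0) ∧ (∀ j : ℕ, (∀ c : ZMod (3 ^ (j + 1)),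 ∃ x ∈ propagatedSelmerStructure W 3 j (Sum.inr v₃), Λfin j x = c) ∧ (∀ x ∈ propagatedSelmerStructure W 3 j (Sum.inr v₃), Λfin j x = 0 ↔ x ∈ W.kummerSelmerStructure (((3 : ℕ) : ℤ) ^ j * ((3 : ℕ) : ℤ)) (Sum.inr v₃))) ∧ (∀ j : ℕ, (∀ (r : Finset (HeightOneSpectrum (RingOfIntegers ℚ))) (Ψ : H1 (tateRep W 3) (cycSubgroup 3 0 r) →+ continuousCohomology 1 (subgroupRep (torsionGaloisModule W (((3 : ℕ) : ℤ) ^ j * ((3 : ℕ) : ℤ))).toTopRep (cycSubgroup 3 0 r))), (∀ (φ : contOneCocycles (subgroupRep (tateRep W 3).toTopRep (cycSubgroup 3 0 r))) (ψ : contOneCocycles (subgroupRep (torsionGaloisModule W (((3 : ℕ) : ℤ) ^ j * ((3 : ℕ) : ℤ))).toTopRep (cycSubgroup 3 0 r))), (∀ g, ((ψ.1 g : geomTorsion W (((3 : ℕ) : ℤ) ^ j * ((3 : ℕ) : ℤ))) : geomPoints W) = proj 3 (j + 1) (φ.1 g)) → Ψ (oneCocycleClass _ φ) = oneCocycleClass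 _ ψ) → ∀ (y : H1 (tateRep W 3) (cycSubgroup 3 0 r)) (κ₀ : galoisCohomology (torsionGaloisModule W (((3 : ℕ) : ℤ) ^ j * ((3 : ℕ) : ℤ))) 1) (s : ℤ_[3]), resSubgroup (torsionGaloisModule W (((3 : ℕ) : ℤ) ^ j * ((3 : ℕ) : ℤ))).toTopRep (cycSubgroup 3 0 r) 1 κ₀ = Ψ y → localization (torsionGaloisModule W (((3 : ℕ) : ℤ) ^ j * ((3 : ℕ) : ℤ))) (Sum.inr v₃) 1 κ₀ ∈ propagatedSelmerStructure W 3 j (Sum.inr v₃) → (∃ l ∈ cycIntLattice 3 (cycLevel 3 0 r), (((3 : ℕ) : ℤ_[3]) ^ 0) • Λ 0 r y - (TensorProduct.tmul ℚ (s : ℚ_[3]) (1 : CyclotomicField (cycLevel 3 0 r) ℚ)) = (((3 : ℕ) : ℤ_[3]) ^ (j + 1)) • (l : TensorProduct ℚ ℚ_[3] (CyclotomicField (cycLevel 3 0 r) ℚ))) → ((3 ^ e : ℕ) : ZMod (3 ^ (j + 1))) * (Λfin j) (localization (torsionGaloisModule W (((3 : ℕ) : ℤ) ^ j * ((3 : ℕ)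 : ℤ))) (Sum.inr v₃) 1 κ₀) = PadicInt.toZModPow (j + 1) s)) ∧ ∀ (c d a : ℤ) (A : ℕ), 0 < A → Int.gcd c (6 * 3 * A) = 1 → Int.gcd d (6 * 3 * N) = 1 → ∃ (z : ∀ (k' : ℕ) (r : (cyclotomicLevelsRat 3 (badPlaces c d A N)).Ideals), H1 (tateRep W 3) ((cyclotomicLevelsRat 3 (badPlaces c d A N)).level k' r.1)) (x : ∀ (k' : ℕ) (r : (cyclotomicLevelsRat 3 (badPlaces c d A N)).Ideals), CyclotomicField (cycLevel 3 k' r.1) ℚ), ZetaBody W 3 P.f ι κK Λ c d a A z x)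

/-- item stmt-BirchSwinnertonDyer-21401 · support · rank 9 · open · by planner
[support · POS] the shared DISPLAYED period-position residual of 19560 / 19077 / 19599 / 20397 /
20275 (w2-c4 g13 `@[conjecture] def KatoPeriodPositionAtThree`,
Theorems/KimAtThreeShallowEqDeepPositionDefs.lean p552920; consumed by p554491
`katoKuriharaPortThreeShared_of_periodPosition_of_cites` and kim3 skeleton v5 `stub_period` token
for token): for every tower-surjective globally-minimal W and every P at N = conductor that is
lattice-optimal, ∃ d ι κK Λ, κK ≠ 0 ∧ KatoPosition W d κK ∧ Kato2004.DefinedExpStarBody W 3 P.f d ι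
κK Λ. STRONGER than Kato 2004 Thm 12.5 (the accepted Literature matrix p550283 gives the body, not
the position; acc5 p552858 `not_forall_zetaFamily_pos` shows position is extra content) — the
ROUTE'S OWN hypothesis, print status PRE (Bullach–Honnor 2025 Thm 2.8 (b)(c) / Bullach–Burns Thm 9.2
/ Burns–Sakamoto–Sano III Rem 6.9); TRUE on paper for Kato's own datum (KIM3-POS-g16 Thm A; acc4 g7
(F1) independent re-derivation), not kernel-typable today. Why it might fail: a lattice-optimal P
whose Kato zeta element lands outside the displayed position at 3 for some tower-surjective W (no
such example known; refuters may attack ¬POS). Provenance KIM3-POS-g16; direc -/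
@[route_item "route-BirchSwinnertonDyer-KimAtThreeKolyvagin", crux]
def KatoPeriodPositionThree : Prop :=
  Summit.BirchSwinnertonDyer.BirchSwinnertonDyer.Theorems.KimAtThreeShallowEqDeepPositionDefs.KatoPeriodPositionAtThree

/-- item stmt-BirchSwinnertonDyer-19078 · assembly · rank 1 · closed · proved by Summit.BirchSwinnertonDyer.BirchSwinnertonDyer.Theorems.kimAtThreeKolyvagin_assembly_proof @ 1d3b5665d0f6 (prover) · by planner
sources: Kim2025RefinedTNC, MazurRubin2004
[assembly] DeepLowerAtThree → DeepUpperAtThree → ShallowEqDeepAtTorsionFree →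
N11.KimAtThreeRankZeroPUB -/
@[route_item "route-BirchSwinnertonDyer-KimAtThreeKolyvagin", crux]
def Assembly : Prop :=
  DeepLowerAtThree → DeepUpperAtThree → ShallowEqDeepAtTorsionFree → Summit.BirchSwinnertonDyer.Rank1Residual.Additive.N11.KimAtThreeRankZeroPUB

-- `Assembly` holds: proved by `Summit.BirchSwinnertonDyer.BirchSwinnertonDyer.Theorems.kimAtThreeKolyvagin_assembly_proof` @ 1d3b5665d0f6 (its module imports this route file, so no `_holds` link can be stated here).

/-! D-0027 §2.1 — DECIDING THEOREM (planner-authored via `route open/edit --closes-file`; by planner-bsd-addord-plan-g12-0 2026-08-26T00:25:55Z):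
its hypotheses are this route's items and its conclusion the registered leaf `Summit.BirchSwinnertonDyer.Rank1Residual.Additive.N11.KimAtThreeRankZeroPUB` (rung W2, D-0061) (glue_lint), and it elaborates with this file. -/

@[closes "route-BirchSwinnertonDyer-KimAtThreeKolyvagin"] theorem closes (h₁ : DeepLowerAtThree) (h₂ : DeepUpperAtThree) (h₃ : ShallowEqDeepAtTorsionFree)
    (hA : Assembly) :
    Summit.BirchSwinnertonDyer.Rank1Residual.Additive.N11.KimAtThreeRankZeroPUB :=
  hA h₁ h₂ h₃

end Summit.BirchSwinnertonDyer.BirchSwinnertonDyer.Theses.KimAtThreeKolyvagin
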